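import Literature.NumberTheory.LFunctions.WeilExplicitFormulaProofs
import Literature.NumberTheory.LFunctions.NicolasMertensRH
import Literature.NumberTheory.LFunctions.ZetaLogDerivRH
import Literature.Analysis.SpecialFunctions.DigammaLogBound
import Literature.Analysis.SpecialFunctions.EulerMascheroniBounds
import HarnessLib

/-!
# The sum `∑_ρ 1/(ρ(1−ρ))` over the non-trivial zeros of `ζ` (Nicolas's `β`)

Topic: `Literature/NumberTheory/LFunctions`. DISCHARGE, as a theorem, of the identity behind the
constant `β` of Nicolas 2012 (`Literature.NumberTheory.LFunctions.nicolasBeta`, `NicolasMertensRH.lean`), which enters the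
RH-explicit Mertens bound `Nicolas2012_logf_lower(_sharp)` (there `|W(x)| ≤ β`, (1.19)) and hence
Robin's and Lagarias's criteria (`RobinColossallyAbundantRH.lean`, `LagariasCriterion.lean`):

  **`∑_ρ m(ρ)/(ρ(1−ρ)) = 2 + γ − log π − 2 log 2 = 0.04619…`**   (Nicolas 2012, (1.3)),

the sum over the non-trivial zeros `ρ` of `ζ` (each listed once, weighted by its multiplicity
`m(ρ) = riemannZetaZeroOrder ρ`), absolutely convergent. Classically this is read off Hadamard's
product for `ξ`: Edwards, *Riemann's Zeta Function*, §3.8 (4), "`∑_ρ 1/ρ = ½γ + ½ log π + 1 − log 2π`"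
(the sum in order of increasing `|Im ρ|`; pairing `ρ` with `1 − ρ` gives `½ ∑_ρ 1/(ρ(1−ρ))`), and
§7.6 (1), "`∑_{Im ρ > 0} 1/(ρ(1−ρ)) = 0.02309…`" (Riemann's own computation). Hadamard's product is
not in Mathlib; we prove the identity instead by the residue theorem, with the tools of the tree's
proof of the Guinand–Weil explicit formula (`WeilExplicitFormulaProofs.lean`):

* the weighted argument principle (`Literature.Analysis.Complex.integral_boundary_rect_logDeriv_mul`) for `ξ` and the
  weight `g(s) = 1/(s(s−1))` on the rectangle `[1−T, T] × [−T, T]`, cut into three horizontal strips: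
  on the middle one, `|Im s| ≤ δ`, `ξ` has no zeros and the two poles `0, 1` of `g` contribute
  `ξ'/ξ(1) − ξ'/ξ(0) = 2 ξ'/ξ(1)` by Cauchy's formula for a rectangle
  (`Literature.Analysis.Complex.rectBoundaryIntegral_const_mul_div_sub`) and `ξ'/ξ(1−s) = −ξ'/ξ(s)`; on the two
  outer ones the zeros contribute `∑_{|Im ρ| < T} m(ρ) g(ρ) = −∑ m(ρ)/(ρ(1−ρ))`
  (`contour_identity`);
* `T` runs through *good heights* `T_N ∈ [N, N+1]` at distance `≫ 1/log N` from every ordinate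
  (`exists_goodHeight_log`, from the tree's `Literature.NumberTheory.LFunctions.ZetaLogDerivRH.exists_goodHeight`, `ZetaLogDerivRH.lean`), so
  that `|ξ'/ξ| ≪ log² T` on the horizontal sides (`Literature.NumberTheory.LFunctions.exists_norm_logDeriv_riemannXi_le`), while on
  `Re s ≥ 3/2` one has `|ξ'/ξ(s)| ≪ log(2+|s|)` off the real axis and `≪ |s|` near it
  (`norm_logDeriv_riemannXi_le_of_re_ge`, from `ξ'/ξ = 1/s + 1/(s−1) − ½log π + ½ψ(s/2) − ∑Λn^{-s}`
  and the digamma bounds of `DigammaLogBound.lean`/`DigammaGauss.lean`); as `|g| ≤ 1/T²` on the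
  boundary, the whole boundary integral is `O(log² T/T) → 0` (`tendsto_contour`);
* `ξ'/ξ(1) = 1 + γ/2 − ½ log π − log 2` (`logDeriv_riemannXi_one`: Mathlib's
  `deriv_riemannZeta₁_one = γ` and `Complex.digamma_one_half`).

Main results (everything PROVED, no named facts):

* `Literature.RH.summable_zeroOrder_div_mul_one_sub`, `Literature.NumberTheory.LFunctions.hasSum_zeroOrder_div_mul_one_sub` —
  `∑_ρ m(ρ)/(ρ(1−ρ))` converges absolutely and equals `nicolasBeta` (as a complex number);
  `Literature.NumberTheory.LFunctions.tsum_zeroOrder_div_mul_one_sub_eq_nicolasBeta`.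
* `Literature.NumberTheory.LFunctions.logDeriv_riemannXi_one` — `ξ'/ξ(1) = nicolasBeta/2`.
* Under RH (`ρ(1−ρ) = |ρ|²`): `Literature.NumberTheory.LFunctions.hasSum_zeroOrder_div_norm_sq_of_RH`
  (`∑_ρ m(ρ)/|ρ|² = β`), `Literature.NumberTheory.LFunctions.sum_zeroOrder_div_norm_sq_le_nicolasBeta` (every finite partial sum
  is `≤ β`), and Nicolas's (1.19): `Literature.NumberTheory.LFunctions.norm_tsum_zeroOrder_mul_div_le_nicolasBeta`
  (`|∑_ρ m(ρ) c(ρ)/(ρ(1−ρ))| ≤ β` whenever `|c(ρ)| ≤ 1`, e.g. `c(ρ) = x^{i Im ρ}`, `W(x)`),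
  `Literature.RH.nicolasBeta_pos`.

## References

* J.-L. Nicolas, *Small values of the Euler function and the Riemann hypothesis*, Acta Arith. 155
  (2012), 311–321 (arXiv:1202.0729), (1.3), (1.18)–(1.19). [Nicolas2012]
* H. M. Edwards, *Riemann's Zeta Function*, Academic Press 1974 (Dover 2001), §3.8 (4) and §7.6 (1)
  (held: `book:edwards1974-riemann-s-zeta-function`, pp. 71, 156). [Edwards1974]
* E. Bombieri, *Remarks on Weil's quadratic functional in the theory of prime numbers I*, Rend.
  Lincei (9) 11 (2000), §2 (the contour and the good heights). [Bombieri2000Weil]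
* H. L. Montgomery, R. C. Vaughan, *Multiplicative Number Theory I*, CUP 2007, Lemma 12.2 (good
  heights), Thm. 10.13. [MontgomeryVaughan2007]
* E. C. Titchmarsh, *The Theory of the Riemann Zeta-Function*, 2nd ed., OUP 1986, §9.2.
  [Titchmarsh1986]
-/

noncomputable section

open Complex Filter Set MeasureTheory Topology intervalIntegral
open scoped Real ComplexConjugate

namespace Literature.NumberTheory.LFunctions

namespace ZetaZeroSum

/-- `m(ρ) ≥ 0` at a non-trivial zero (as a real number). [folklore] -/
theorem zeroOrder_nonneg (ρ : RHWave0.riemannZetaNontrivialZeros) :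
    (0 : ℝ) ≤ riemannZetaZeroOrder (ρ : ℂ) := by
  exact_mod_cast riemannZetaZeroOrder_nonneg (ZetaZeros.riemannZetaNontrivialZeros.ne_one ρ.2)

/-! ### The zeros stay away from the real axis -/

/-- There is `δ ∈ (0, 1/2]` such that every non-trivial zero has `|Im ρ| ≥ 2δ` (the zeros with
`|Im ρ| ≤ 1` lie in a compact set, hence are finite in number, and none is real). [folklore] -/
theorem exists_gap_im :
    ∃ δ : ℝ, 0 < δ ∧ δ ≤ 1 / 2 ∧ ∀ ρ ∈ RHWave0.riemannZetaNontrivialZeros, 2 * δ ≤ |ρ.im| := by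
  have hfin := riemannZetaNontrivialZeros_finite_inter_ball (1 / 2) 2
  set A : Finset ℝ := insert 1 (hfin.toFinset.image fun ρ ↦ |ρ.im|) with hA
  have hne : A.Nonempty := ⟨1, Finset.mem_insert_self _ _⟩
  have hpos : ∀ a ∈ A, 0 < a := by
    intro a ha
    rw [hA, Finset.mem_insert, Finset.mem_image] at ha
    rcases ha with rfl | ⟨ρ, hρ, rfl⟩
    · exact one_pos
    · rw [Set.Finite.mem_toFinset] at hρ
      exact abs_pos.2 (ZetaZeros.riemannZetaNontrivialZeros.im_ne_zero hρ.1)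
  set m := A.min' hne with hm
  have hm0 : 0 < m := hpos _ (Finset.min'_mem _ _)
  have hm1 : m ≤ 1 := Finset.min'_le _ _ (Finset.mem_insert_self _ _)
  refine ⟨m / 2, by positivity, by linarith, fun ρ hρ ↦ ?_⟩
  rw [show 2 * (m / 2) = m by ring]
  by_cases hρ1 : |ρ.im| ≤ 1
  · refine Finset.min'_le _ _ ?_
    rw [hA, Finset.mem_insert, Finset.mem_image]
    refine Or.inr ⟨ρ, ?_, rfl⟩
    rw [Set.Finite.mem_toFinset]
    refine ⟨hρ, ?_⟩
    rw [Metric.mem_ball, dist_eq_norm]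
    have h0 := ZetaZeros.riemannZetaNontrivialZeros.re_pos hρ
    have h1 := ZetaZeros.riemannZetaNontrivialZeros.re_lt_one hρ
    have hre : |(ρ - 1 / 2).re| ≤ 1 / 2 := by
      rw [abs_le]; simp; constructor <;> linarith
    have him : |(ρ - 1 / 2).im| ≤ 1 := by simpa using hρ1
    calc ‖ρ - 1 / 2‖ ≤ |(ρ - 1 / 2).re| + |(ρ - 1 / 2).im| := Complex.norm_le_abs_re_add_abs_im _
      _ < 2 := by linarith
  · push Not at hρ1
    linarith

/-! ### Good heights with `1/η ≪ log N` -/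

/-- **Good heights, logarithmic form** (from the tree's `Literature.NumberTheory.LFunctions.ZetaLogDerivRH.exists_goodHeight`,
Montgomery–Vaughan Lemma 12.2): there is `A > 0` such that in every `[N, N+1]`, `N ≥ 2`, some
height `T` is at distance `≥ η` from the ordinate of every non-trivial zero, with `0 < η ≤ 1/2` and
`1/η ≤ A log(N + 6)` (the zeros with `Re ρ < 1/4` have the same ordinates as their reflections
`1 − ρ̄ ∈ zetaZerosRight`). [cite: MontgomeryVaughan2007, Lemma 12.2 (proof)] -/
theorem exists_goodHeight_log :
    ∃ A : ℝ, 0 < A ∧ ∀ N : ℕ, 2 ≤ N → ∃ T : ℝ, (N : ℝ) ≤ T ∧ T ≤ N + 1 ∧ ∃ η : ℝ, 0 < η ∧ η ≤ 1 / 2 ∧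
      1 / η ≤ A * Real.log (N + 6) ∧ ∀ ρ ∈ RHWave0.riemannZetaNontrivialZeros, η ≤ |ρ.im - T| := by
  obtain ⟨c₀, hc₀, hgood⟩ := ZetaLogDerivRH.exists_goodHeight
  refine ⟨2 + 1 / c₀, by positivity, fun N hN ↦ ?_⟩
  obtain ⟨T, ⟨hT1, hT2⟩, hsep⟩ := hgood N
  have hN2 : (2 : ℝ) ≤ N := by exact_mod_cast hN
  have hT0 : 0 ≤ T := by linarith
  have hlogT : 0 < Real.log (|T| + 2) := Real.log_pos (by linarith [abs_nonneg T])
  set η : ℝ := min (1 / 2) (c₀ / Real.log (|T| + 2)) with hη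
  have hη0 : 0 < η := lt_min (by norm_num) (div_pos hc₀ hlogT)
  refine ⟨T, hT1, hT2, η, hη0, min_le_left _ _, ?_, ?_⟩
  · have hlogle : Real.log (|T| + 2) ≤ Real.log ((N : ℝ) + 6) := by
      rw [abs_of_nonneg hT0]
      exact Real.log_le_log (by linarith) (by linarith)
    have hlog1 : 1 ≤ Real.log ((N : ℝ) + 6) := by
      rw [Real.le_log_iff_exp_le (by positivity)]
      linarith [Real.exp_one_lt_d9]
    have h1 : 1 / η ≤ 2 + Real.log (|T| + 2) / c₀ := by
      rcases min_cases (1 / 2 : ℝ) (c₀ / Real.log (|T| + 2)) with ⟨h, -⟩ | ⟨h, -⟩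
      · rw [hη, h]
        have : 0 ≤ Real.log (|T| + 2) / c₀ := by positivity
        linarith
      · rw [hη, h, one_div_div]
        linarith
    calc 1 / η ≤ 2 + Real.log (|T| + 2) / c₀ := h1
      _ ≤ 2 * Real.log ((N : ℝ) + 6) + Real.log ((N : ℝ) + 6) / c₀ := by
          gcongr; linarith
      _ = (2 + 1 / c₀) * Real.log (N + 6) := by ring
  · intro ρ hρ
    rcases le_or_gt (1 / 4 : ℝ) ρ.re with h | h
    · exact (min_le_right _ _).trans (hsep ρ ⟨ZetaZeros.riemannZetaNontrivialZeros.zeta_eq_zero hρ, h⟩)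
    · have h' := ZetaZeros.riemannZetaNontrivialZeros.one_sub_conj_mem hρ
      have h1 := hsep _ ⟨ZetaZeros.riemannZetaNontrivialZeros.zeta_eq_zero h', by simp; linarith⟩
      simp only [sub_im, one_im, conj_im, zero_sub, neg_neg] at h1
      exact (min_le_right _ _).trans h1

/-! ### `ξ'/ξ` on the half-plane `Re s ≥ 3/2` -/

/-- A linear bound for `ψ` near the real axis: `‖ψ(w)‖ ≤ 1 + 3‖w − 1‖` for `Re w ≥ 3/4` (from the
series `ψ(w) + γ = ∑ (1/(k+1) − 1/(w+k))`, whose terms are `≤ ‖w−1‖/(¾(k+1)²)`, and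
`∑ 1/(k+1)² = π²/6 < 5/3`, `γ < 2/3`). [folklore] -/
theorem norm_digamma_le_linear {w : ℂ} (hw : 3 / 4 ≤ w.re) : ‖digamma w‖ ≤ 1 + 3 * ‖w - 1‖ := by
  have hw0 : 0 < w.re := by linarith
  have hs := Literature.Analysis.SpecialFunctions.Complex.hasSum_one_div_sub_one_div_digamma hw0
  have hmin : 3 / 4 ≤ min w.re 1 := le_min hw (by norm_num)
  -- the dominating series
  have hdom : HasSum (fun k : ℕ ↦ ‖w - 1‖ / (3 / 4) * (1 / ((k : ℝ) + 1) ^ 2))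
      (‖w - 1‖ / (3 / 4) * (π ^ 2 / 6)) := by
    have h := (hasSum_nat_add_iff' 1).2 (hasSum_zeta_two)
    simp only [Finset.range_one, Finset.sum_singleton, Nat.cast_zero, ne_eq, OfNat.ofNat_ne_zero,
      not_false_eq_true, zero_pow, div_zero, sub_zero, Nat.cast_add, Nat.cast_one] at h
    exact h.mul_left _
  have hle : ∀ k : ℕ, ‖1 / ((k : ℂ) + 1) - 1 / (w + k)‖ ≤ ‖w - 1‖ / (3 / 4) * (1 / ((k : ℝ) + 1) ^ 2) := by
    intro k
    refine (Literature.Analysis.SpecialFunctions.Complex.norm_one_div_sub_one_div_le hw0 k).trans ?_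
    rw [show ‖w - 1‖ / (3 / 4) * (1 / ((k : ℝ) + 1) ^ 2) = ‖w - 1‖ / (3 / 4 * ((k : ℝ) + 1) ^ 2) by
      field_simp]
    exact div_le_div_of_nonneg_left (norm_nonneg _) (by positivity)
      (mul_le_mul_of_nonneg_right hmin (by positivity))
  have h1 : ‖digamma w + Real.eulerMascheroniConstant‖ ≤ ‖w - 1‖ / (3 / 4) * (π ^ 2 / 6) := by
    rw [← hs.tsum_eq]
    refine (norm_tsum_le_tsum_norm hs.summable.norm).trans ?_
    rw [← hdom.tsum_eq]
    exact hs.summable.norm.tsum_le_tsum hle hdom.summable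
  have hγ : ‖(Real.eulerMascheroniConstant : ℂ)‖ ≤ 2 / 3 := by
    rw [Complex.norm_real, Real.norm_eq_abs, abs_of_pos (by
      linarith [Real.one_half_lt_eulerMascheroniConstant])]
    linarith [Real.eulerMascheroniConstant_lt_two_thirds]
  have hπ : π ^ 2 / 6 ≤ 5 / 3 := by nlinarith [Real.pi_lt_d2, Real.pi_pos]
  have h2 : ‖digamma w‖ ≤ ‖digamma w + Real.eulerMascheroniConstant‖ +
      ‖(Real.eulerMascheroniConstant : ℂ)‖ := by
    have := norm_sub_le (digamma w + Real.eulerMascheroniConstant) (Real.eulerMascheroniConstant : ℂ)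
    simpa using this
  have h3 : ‖w - 1‖ / (3 / 4) * (π ^ 2 / 6) ≤ 3 * ‖w - 1‖ := by
    rw [div_mul_eq_mul_div, div_le_iff₀ (by norm_num)]
    nlinarith [norm_nonneg (w - 1)]
  linarith

/-- `|∑ Λ(n) n^{-s}| ≤ ∑ Λ(n) n^{-3/2}` for `Re s ≥ 3/2`. [folklore] -/
theorem norm_LSeries_vonMangoldt_le_of_re_ge {s : ℂ} (hs : 3 / 2 ≤ s.re) :
    ‖LSeries (fun n ↦ (ArithmeticFunction.vonMangoldt n : ℂ)) s‖ ≤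
      ∑' n : ℕ, ‖LSeries.term (fun n ↦ (ArithmeticFunction.vonMangoldt n : ℂ)) (3 / 2 : ℂ) n‖ := by
  set f : ℕ → ℂ := fun n ↦ (ArithmeticFunction.vonMangoldt n : ℂ) with hf
  have hsum3 : Summable fun n ↦ ‖LSeries.term f (3 / 2 : ℂ) n‖ := by
    have h := ArithmeticFunction.LSeriesSummable_vonMangoldt (s := (3 / 2 : ℂ)) (by norm_num)
    exact summable_norm_iff.mpr h
  have hle : ∀ n, ‖LSeries.term f s n‖ ≤ ‖LSeries.term f (3 / 2 : ℂ) n‖ := fun n ↦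
    LSeries.norm_term_le_of_re_le_re f (by simpa using hs) n
  have hsum : Summable fun n ↦ ‖LSeries.term f s n‖ :=
    Summable.of_nonneg_of_le (fun _ ↦ norm_nonneg _) hle hsum3
  calc ‖LSeries f s‖ = ‖∑' n, LSeries.term f s n‖ := rfl
    _ ≤ ∑' n, ‖LSeries.term f s n‖ := norm_tsum_le_tsum_norm hsum
    _ ≤ ∑' n, ‖LSeries.term f (3 / 2 : ℂ) n‖ := hsum.tsum_le_tsum hle hsum3

/-- **`ξ'/ξ` on `Re s ≥ 3/2`.** There is `C > 0` with `‖ξ'/ξ(s)‖ ≤ C + ‖s‖` for all `s` with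
`Re s ≥ 3/2`, and `‖ξ'/ξ(s)‖ ≤ C + log(1 + ‖s‖)` if moreover `|Im s| ≥ 1` (from
`ξ'/ξ = 1/s + 1/(s−1) − ½ log π + ½ ψ(s/2) − ∑ Λ(n) n^{-s}` and the two digamma bounds).
[cite: Bombieri2000Weil, §2] -/
theorem exists_norm_logDeriv_riemannXi_le_of_re_ge :
    ∃ C : ℝ, 0 < C ∧ ∀ s : ℂ, 3 / 2 ≤ s.re →
      ‖logDeriv riemannXi s‖ ≤ C + ‖s‖ ∧
        (1 ≤ |s.im| → ‖logDeriv riemannXi s‖ ≤ C + Real.log (1 + ‖s‖)) := by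
  set M : ℝ := ∑' n : ℕ, ‖LSeries.term (fun n ↦ (ArithmeticFunction.vonMangoldt n : ℂ))
    (3 / 2 : ℂ) n‖ with hM
  have hM0 : 0 ≤ M := tsum_nonneg fun _ ↦ norm_nonneg _
  refine ⟨8 + M, by positivity, fun s hs ↦ ?_⟩
  have hre : 1 < s.re := by linarith
  rw [logDeriv_riemannXi_eq_of_one_lt_re hre]
  have hns : 3 / 2 ≤ ‖s‖ := hs.trans (Complex.re_le_norm s)
  have h1 : ‖1 / s‖ ≤ 2 / 3 := by
    rw [norm_div, norm_one, div_le_div_iff₀ (by linarith) (by norm_num)]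
    linarith
  have h2 : ‖1 / (s - 1)‖ ≤ 2 := by
    rw [norm_div, norm_one]
    have : (1 / 2 : ℝ) ≤ ‖s - 1‖ := by
      have h := Complex.re_le_norm (s - 1)
      simp only [sub_re, one_re] at h
      linarith
    rw [div_le_iff₀ (by linarith)]
    linarith
  have hπ : ‖(-(Real.log π : ℂ)) / 2‖ ≤ 1 := by
    rw [norm_div, norm_neg, Complex.norm_real, Real.norm_eq_abs, Complex.norm_two,
      abs_of_pos (Real.log_pos (by linarith [Real.pi_gt_three]))]
    linarith [log_pi_lt_two]
  have h4 : ‖LSeries (fun n ↦ (ArithmeticFunction.vonMangoldt n : ℂ)) s‖ ≤ M :=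
    norm_LSeries_vonMangoldt_le_of_re_ge hs
  have hw : 3 / 4 ≤ (s / 2).re := by simp; linarith
  -- the general (linear) bound
  have hψlin : ‖(1 / 2 : ℂ) * digamma (s / 2)‖ ≤ 2 + 3 / 4 * ‖s‖ := by
    rw [norm_mul, show ‖(1 / 2 : ℂ)‖ = 1 / 2 by simp]
    have h := norm_digamma_le_linear hw
    have h' : ‖s / 2 - 1‖ ≤ ‖s‖ / 2 + 1 := by
      calc ‖s / 2 - 1‖ ≤ ‖s / 2‖ + ‖(1 : ℂ)‖ := norm_sub_le _ _
        _ = ‖s‖ / 2 + 1 := by simp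
    nlinarith [norm_nonneg (s / 2 - 1), norm_nonneg s]
  have main : ∀ B : ℝ, ‖(1 / 2 : ℂ) * digamma (s / 2)‖ ≤ B →
      ‖1 / s + 1 / (s - 1) + (-(Real.log π : ℂ) / 2 + 1 / 2 * digamma (s / 2)) -
        LSeries (fun n ↦ (ArithmeticFunction.vonMangoldt n : ℂ)) s‖ ≤ 2 / 3 + 2 + (1 + B) + M := by
    intro B hB
    calc _ ≤ ‖1 / s + 1 / (s - 1) + (-(Real.log π : ℂ) / 2 + 1 / 2 * digamma (s / 2))‖ +
          ‖LSeries (fun n ↦ (ArithmeticFunction.vonMangoldt n : ℂ)) s‖ := norm_sub_le _ _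
      _ ≤ ‖1 / s‖ + ‖1 / (s - 1)‖ + ‖-(Real.log π : ℂ) / 2 + 1 / 2 * digamma (s / 2)‖ +
          ‖LSeries (fun n ↦ (ArithmeticFunction.vonMangoldt n : ℂ)) s‖ := by
          gcongr; exact norm_add₃_le
      _ ≤ 2 / 3 + 2 + (1 + B) + M := by
          gcongr
          exact (norm_add_le _ _).trans (add_le_add hπ hB)
  refine ⟨(main _ hψlin).trans (by nlinarith [norm_nonneg s]), fun him ↦ ?_⟩
  -- the logarithmic bound off the real axis
  have hψlog : ‖(1 / 2 : ℂ) * digamma (s / 2)‖ ≤ 4 + Real.log (1 + ‖s‖) / 2 := by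
    rw [norm_mul, show ‖(1 / 2 : ℂ)‖ = 1 / 2 by simp]
    have hy : 1 / 2 ≤ |(s / 2).im| := by
      simp only [Complex.div_ofNat_im, abs_div, abs_two]
      linarith
    have h := Literature.Analysis.SpecialFunctions.Complex.norm_digamma_le_log (by linarith : 0 < (s / 2).re) hy
    have hlog : Real.log (1 + ‖s / 2‖) ≤ Real.log (1 + ‖s‖) := by
      refine Real.log_le_log (by positivity) ?_
      rw [norm_div, Complex.norm_two]
      linarith [norm_nonneg s]
    linarith
  have hlog0 : 0 ≤ Real.log (1 + ‖s‖) := Real.log_nonneg (by linarith [norm_nonneg s])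
  exact (main _ hψlog).trans (by linarith)

/-! ### The value `ξ'/ξ(1) = 1 + γ/2 − ½ log π − log 2` -/

/-- **`ξ'/ξ(1) = β/2`**, `β = 2 + γ − log π − 2 log 2` (`nicolasBeta`): from
`ξ'/ξ = 1/s + Γ_ℝ'/Γ_ℝ + ζ₁'/ζ₁`, `Γ_ℝ'/Γ_ℝ(1) = −½ log π + ½ ψ(½)`, `ψ(½) = −γ − 2 log 2`
(`Complex.digamma_one_half`) and `ζ₁'(1) = γ` (`deriv_riemannZeta₁_one`), `ζ₁(1) = 1`; this is
Edwards's `∑ 1/ρ = ½γ + ½ log π + 1 − log 2π` (`= ξ'/ξ(1) = −ξ'/ξ(0)`). [cite: Edwards1974, §3.8 (4)] -/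
theorem logDeriv_riemannXi_one : logDeriv riemannXi 1 = (nicolasBeta : ℂ) / 2 := by
  have hζ : riemannZeta₁ 1 ≠ 0 := by rw [riemannZeta₁_one]; exact one_ne_zero
  rw [logDeriv_riemannXi_eq (s := 1) (by simp) hζ]
  have hhalf : ∀ m : ℕ, (1 : ℂ) / 2 ≠ -m := by
    intro m h
    have := congrArg Complex.re h
    simp at this
    linarith [(m.cast_nonneg : (0 : ℝ) ≤ m)]
  rw [logDeriv_Gammaℝ hhalf, logDeriv_apply, deriv_riemannZeta₁_one, riemannZeta₁_one,
    Complex.digamma_one_half]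
  have hlogπ : Complex.log π = (Real.log π : ℂ) := (Complex.ofReal_log Real.pi_pos.le).symm
  have hlog2 : Complex.log 2 = (Real.log 2 : ℂ) := by
    rw [show (2 : ℂ) = ((2 : ℝ) : ℂ) by norm_num, ← Complex.ofReal_log (by norm_num)]
  rw [hlogπ, hlog2, nicolasBeta]
  push_cast
  ring

/-! ### The weight `g(s) = 1/(s(s−1))` and the integrand `(ξ'/ξ)·g` -/

/-- The weight `g(s) = 1/(s(s−1))`: analytic off `{0, 1}`, even under `s ↦ 1 − s`, of size
`1/(|s||s−1|)`, and `g(ρ) = −1/(ρ(1−ρ))`. [folklore] -/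
def recipWeight (s : ℂ) : ℂ := 1 / (s * (s - 1))

/-- The contour integrand `F(s) = ξ'/ξ(s) · g(s)`. [folklore] -/
def contourIntegrand (s : ℂ) : ℂ := logDeriv riemannXi s * recipWeight s

/-- `g(1 − s) = g(s)`. [folklore] -/
theorem recipWeight_one_sub (s : ℂ) : recipWeight (1 - s) = recipWeight s := by
  unfold recipWeight; ring

/-- `g(s) = −1/(s(1−s))`. [folklore] -/
theorem recipWeight_eq_neg (s : ℂ) : recipWeight s = -(1 / (s * (1 - s))) := by
  unfold recipWeight
  rw [show s * (1 - s) = -(s * (s - 1)) by ring, one_div_neg_eq_neg_one_div, neg_neg]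

/-- `‖g(s)‖ = 1/(‖s‖ ‖s−1‖)`. [folklore] -/
theorem norm_recipWeight (s : ℂ) : ‖recipWeight s‖ = 1 / (‖s‖ * ‖s - 1‖) := by
  simp [recipWeight]

/-- `g` is analytic off `{0, 1}`. [folklore] -/
theorem analyticAt_recipWeight {s : ℂ} (h0 : s ≠ 0) (h1 : s ≠ 1) : AnalyticAt ℂ recipWeight s := by
  refine analyticAt_const.div (analyticAt_id.mul (analyticAt_id.sub analyticAt_const)) ?_
  exact mul_ne_zero h0 (sub_ne_zero.2 h1)

/-- Off the real axis the weight is analytic. [folklore] -/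
theorem analyticAt_recipWeight_of_im_ne_zero {s : ℂ} (h : s.im ≠ 0) : AnalyticAt ℂ recipWeight s :=
  analyticAt_recipWeight (fun h0 ↦ h (by simp [h0])) (fun h1 ↦ h (by simp [h1]))

/-- `ξ'/ξ` is analytic off the zeros of `ξ`. [folklore] -/
theorem analyticAt_logDeriv_riemannXi {s : ℂ} (hs : riemannXi s ≠ 0) :
    AnalyticAt ℂ (logDeriv riemannXi) s := by
  have h : logDeriv riemannXi = fun z ↦ deriv riemannXi z / riemannXi z := by
    funext z; rw [logDeriv_apply]
  rw [h]
  exact (differentiable_riemannXi.analyticAt s).deriv.div (differentiable_riemannXi.analyticAt s) hs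

/-- The integrand is continuous at every point `s ∉ {0, 1}` where `ξ(s) ≠ 0`. [folklore] -/
theorem continuousAt_contourIntegrand {s : ℂ} (hξ : riemannXi s ≠ 0) (h0 : s ≠ 0) (h1 : s ≠ 1) :
    ContinuousAt contourIntegrand s :=
  ((analyticAt_logDeriv_riemannXi hξ).continuousAt).mul (analyticAt_recipWeight h0 h1).continuousAt

/-- `ξ(s) ≠ 0` for `Re s ≤ 0` or `Re s ≥ 1`. [folklore] -/
theorem riemannXi_ne_zero_of_re_not_mem {s : ℂ} (h : s.re ≤ 0 ∨ 1 ≤ s.re) : riemannXi s ≠ 0 := by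
  rcases h with h | h
  · exact riemannXi_ne_zero_of_re_le_zero h
  · exact riemannXi_ne_zero_of_one_le_re h

/-- The integrand is continuous at every point off the real axis where `ξ ≠ 0`. [folklore] -/
theorem continuousAt_contourIntegrand_of_im_ne_zero {s : ℂ} (hξ : riemannXi s ≠ 0) (h : s.im ≠ 0) :
    ContinuousAt contourIntegrand s :=
  continuousAt_contourIntegrand hξ (fun h0 ↦ h (by simp [h0])) (fun h1 ↦ h (by simp [h1]))

/-! ### Splitting a rectangle boundary integral along a horizontal line -/

/-- Cutting the rectangle `[a,b] × [c,d]` along `Im z = e` (`c ≤ e ≤ d`): the boundary integral is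
the sum of the boundary integrals of the two pieces (the cut is traversed twice, in opposite
directions), provided the vertical edges are integrable. [folklore] -/
theorem rectBoundaryIntegral_split {F : ℂ → ℂ} {a b c e d : ℝ}
    (hl₁ : IntervalIntegrable (fun y : ℝ ↦ F (a + y * I)) volume c e)
    (hl₂ : IntervalIntegrable (fun y : ℝ ↦ F (a + y * I)) volume e d)
    (hr₁ : IntervalIntegrable (fun y : ℝ ↦ F (b + y * I)) volume c e)
    (hr₂ : IntervalIntegrable (fun y : ℝ ↦ F (b + y * I)) volume e d) :
    Literature.Analysis.Complex.rectBoundaryIntegral F a b c d =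
      Literature.Analysis.Complex.rectBoundaryIntegral F a b c e + Literature.Analysis.Complex.rectBoundaryIntegral F a b e d := by
  simp only [Literature.Analysis.Complex.rectBoundaryIntegral]
  rw [← integral_add_adjacent_intervals hr₁ hr₂, ← integral_add_adjacent_intervals hl₁ hl₂]
  ring

/-! ### The three strips -/

/-- **The middle strip.** If `a < 0`, `1 < b`, `0 < δ` and `ξ` has no zero `s` with
`Re s ∈ [a, b]`, `|Im s| ≤ δ`, then `∮_{∂([a,b]×[−δ,δ])} (ξ'/ξ) g = 4πi · ξ'/ξ(1)`: the poles of
`g = 1/(s−1) − 1/s` at `1` and `0` contribute `ξ'/ξ(1)` and `−ξ'/ξ(0) = ξ'/ξ(1)` by Cauchy's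
formula for the rectangle. [folklore] -/
theorem rectBoundaryIntegral_middle {a b δ : ℝ} (ha : a < 0) (hb : 1 < b) (hδ : 0 < δ)
    (hZ : ∀ s : ℂ, s ∈ Icc a b ×ℂ Icc (-δ) δ → riemannXi s ≠ 0) :
    Literature.Analysis.Complex.rectBoundaryIntegral contourIntegrand a b (-δ) δ =
      4 * π * I * logDeriv riemannXi 1 := by
  have hab : a ≤ b := by linarith
  have hδδ : -δ ≤ δ := by linarith
  set Lf := logDeriv riemannXi with hLf
  -- `ξ'/ξ` is differentiable on the closed strip
  have hLd : DifferentiableOn ℂ Lf (Icc a b ×ℂ Icc (-δ) δ) := fun s hs ↦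
    (analyticAt_logDeriv_riemannXi (hZ s hs)).differentiableAt.differentiableWithinAt
  -- the two pieces
  set G₁ : ℂ → ℂ := fun z ↦ 1 * (Lf z / (z - 1)) with hG₁
  set G₀ : ℂ → ℂ := fun z ↦ (-1) * (Lf z / (z - 0)) with hG₀
  have hsplit : ∀ z : ℂ, z ≠ 0 → z ≠ 1 → contourIntegrand z = G₁ z + G₀ z := by
    intro z h0 h1
    simp only [contourIntegrand, recipWeight, hG₁, hG₀, hLf, sub_zero]
    field_simp
    ring
  -- boundary points are off `{0, 1}`
  have hbdry_h : ∀ (y : ℝ), (y = -δ ∨ y = δ) → ∀ x ∈ Icc a b,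
      ((x : ℂ) + y * I) ≠ 0 ∧ ((x : ℂ) + y * I) ≠ 1 ∧ ((x : ℂ) + y * I) ∈ Icc a b ×ℂ Icc (-δ) δ := by
    intro y hy x hx
    have hy0 : y ≠ 0 := by rcases hy with rfl | rfl <;> simp [hδ.ne']
    refine ⟨fun h ↦ hy0 (by simpa using congrArg Complex.im h),
      fun h ↦ hy0 (by simpa using congrArg Complex.im h), ?_⟩
    refine ⟨by simpa using hx, ?_⟩
    rcases hy with rfl | rfl <;> simp [hδδ]
  have hbdry_v : ∀ (x : ℝ), (x = a ∨ x = b) → ∀ y ∈ Icc (-δ) δ,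
      ((x : ℂ) + y * I) ≠ 0 ∧ ((x : ℂ) + y * I) ≠ 1 ∧ ((x : ℂ) + y * I) ∈ Icc a b ×ℂ Icc (-δ) δ := by
    intro x hx y hy
    have hx0 : x ≠ 0 := by
      rcases hx with rfl | rfl
      · exact ha.ne
      · exact (zero_lt_one.trans hb).ne'
    have hx1 : x ≠ 1 := by
      rcases hx with rfl | rfl
      · exact (ha.trans zero_lt_one).ne
      · exact hb.ne'
    refine ⟨fun h ↦ hx0 (by simpa using congrArg Complex.re h),
      fun h ↦ hx1 (by simpa using congrArg Complex.re h), ?_⟩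
    refine ⟨?_, by simpa using hy⟩
    rcases hx with rfl | rfl <;> simp [hab]
  have hcont : ∀ (m ρ : ℂ), ρ = 0 ∨ ρ = 1 → ∀ z : ℂ, z ≠ 0 → z ≠ 1 → z ∈ Icc a b ×ℂ Icc (-δ) δ →
      ContinuousAt (fun z ↦ m * (Lf z / (z - ρ))) z := by
    intro m ρ hρ z h0 h1 hz
    have hne : z - ρ ≠ 0 := by
      rcases hρ with rfl | rfl
      · simpa using h0
      · exact sub_ne_zero.2 h1
    exact continuousAt_const.mul
      (((analyticAt_logDeriv_riemannXi (hZ z hz)).continuousAt).div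
        (continuousAt_id.sub continuousAt_const) hne)
  rw [Literature.Analysis.Complex.rectBoundaryIntegral_congr (G := fun z ↦ G₁ z + G₀ z) hab hδδ
      (fun x hx ↦ hsplit _ (hbdry_h _ (Or.inl rfl) x hx).1 (hbdry_h _ (Or.inl rfl) x hx).2.1)
      (fun x hx ↦ hsplit _ (hbdry_h _ (Or.inr rfl) x hx).1 (hbdry_h _ (Or.inr rfl) x hx).2.1)
      (fun y hy ↦ hsplit _ (hbdry_v _ (Or.inl rfl) y hy).1 (hbdry_v _ (Or.inl rfl) y hy).2.1)
      (fun y hy ↦ hsplit _ (hbdry_v _ (Or.inr rfl) y hy).1 (hbdry_v _ (Or.inr rfl) y hy).2.1)]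
  rw [Literature.Analysis.Complex.rectBoundaryIntegral_add (F := G₁) (G := G₀) hab hδδ
      (fun x hx ↦ hcont 1 1 (Or.inr rfl) _ (hbdry_h _ (Or.inl rfl) x hx).1
        (hbdry_h _ (Or.inl rfl) x hx).2.1 (hbdry_h _ (Or.inl rfl) x hx).2.2)
      (fun x hx ↦ hcont 1 1 (Or.inr rfl) _ (hbdry_h _ (Or.inr rfl) x hx).1
        (hbdry_h _ (Or.inr rfl) x hx).2.1 (hbdry_h _ (Or.inr rfl) x hx).2.2)
      (fun y hy ↦ hcont 1 1 (Or.inr rfl) _ (hbdry_v _ (Or.inl rfl) y hy).1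
        (hbdry_v _ (Or.inl rfl) y hy).2.1 (hbdry_v _ (Or.inl rfl) y hy).2.2)
      (fun y hy ↦ hcont 1 1 (Or.inr rfl) _ (hbdry_v _ (Or.inr rfl) y hy).1
        (hbdry_v _ (Or.inr rfl) y hy).2.1 (hbdry_v _ (Or.inr rfl) y hy).2.2)
      (fun x hx ↦ hcont (-1) 0 (Or.inl rfl) _ (hbdry_h _ (Or.inl rfl) x hx).1
        (hbdry_h _ (Or.inl rfl) x hx).2.1 (hbdry_h _ (Or.inl rfl) x hx).2.2)
      (fun x hx ↦ hcont (-1) 0 (Or.inl rfl) _ (hbdry_h _ (Or.inr rfl) x hx).1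
        (hbdry_h _ (Or.inr rfl) x hx).2.1 (hbdry_h _ (Or.inr rfl) x hx).2.2)
      (fun y hy ↦ hcont (-1) 0 (Or.inl rfl) _ (hbdry_v _ (Or.inl rfl) y hy).1
        (hbdry_v _ (Or.inl rfl) y hy).2.1 (hbdry_v _ (Or.inl rfl) y hy).2.2)
      (fun y hy ↦ hcont (-1) 0 (Or.inl rfl) _ (hbdry_v _ (Or.inr rfl) y hy).1
        (hbdry_v _ (Or.inr rfl) y hy).2.1 (hbdry_v _ (Or.inr rfl) y hy).2.2)]
  rw [Literature.Analysis.Complex.rectBoundaryIntegral_const_mul_div_sub 1 1 (by simp; linarith) (by simp; linarith)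
      (by simp [hδ]) (by simp [hδ]) hLd,
    Literature.Analysis.Complex.rectBoundaryIntegral_const_mul_div_sub (-1) 0 (by simp [ha]) (by simp; linarith)
      (by simp [hδ]) (by simp [hδ]) hLd]
  have h0 : Lf 0 = -Lf 1 := by
    have := logDeriv_riemannXi_one_sub 1
    rwa [sub_self] at this
  rw [h0]
  ring

/-- **An outer strip.** For a closed rectangle `[a,b] × [c,d]` not meeting the real axis
(`0 < c` or `d < 0`), with `a ≤ 0`, `1 ≤ b`, and no zero of `ξ` on its bottom and top edges,
`∮ (ξ'/ξ) g = 2πi ∑_{ξ(ρ) = 0, ρ inside} m(ρ) g(ρ)` (the weighted argument principle; `g` is analytic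
on the strip and `ξ ≠ 0` on the vertical edges). [folklore] -/
theorem rectBoundaryIntegral_outer {a b c d : ℝ} (ha : a ≤ 0) (hb : 1 ≤ b) (hcd : c < d)
    (h0 : 0 < c ∨ d < 0)
    (h_bot : ∀ x ∈ Icc a b, riemannXi (x + c * I) ≠ 0)
    (h_top : ∀ x ∈ Icc a b, riemannXi (x + d * I) ≠ 0) :
    Literature.Analysis.Complex.rectBoundaryIntegral contourIntegrand a b c d =
      2 * π * I * ∑ᶠ ρ ∈ {ρ : ℂ | riemannXi ρ = 0 ∧ ρ ∈ Ioo a b ×ℂ Ioo c d},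
        ((meromorphicOrderAt riemannXi ρ).untop₀ : ℂ) * recipWeight ρ := by
  have hab : a < b := by linarith
  have him : ∀ z ∈ Icc a b ×ℂ Icc c d, z.im ≠ 0 := by
    intro z hz h
    have h1 : z.im ∈ Icc c d := hz.2
    rw [h] at h1
    rcases h0 with h0 | h0
    · linarith [h1.1]
    · linarith [h1.2]
  have key := Literature.Analysis.Complex.integral_boundary_rect_logDeriv_mul (f := riemannXi) (g := recipWeight)
    hab hcd (fun z _ ↦ differentiable_riemannXi.analyticAt z)
    (fun z hz ↦ analyticAt_recipWeight_of_im_ne_zero (him z hz)) h_bot h_top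
    (fun y _ ↦ riemannXi_ne_zero_of_re_le_zero (by simpa using ha))
    (fun y _ ↦ riemannXi_ne_zero_of_one_le_re (by simpa using hb))
  simp only [← logDeriv_apply] at key
  rw [← key, Literature.Analysis.Complex.rectBoundaryIntegral]
  rfl

/-! ### Finite sums over the truncations `weilZeroFinset T` -/

/-- A `finsum` over `weilZeroIndex T` is the `Finset` sum over `weilZeroFinset T` (generalises
`Literature.NumberTheory.LFunctions.weilZeroSidePartial_eq_sum` to an arbitrary summand). [folklore] -/
theorem finsum_mem_weilZeroIndex_eq_sum (a : ℂ → ℂ) (T : ℝ) :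
    ∑ᶠ ρ ∈ weilZeroIndex T, a ρ = ∑ ρ ∈ weilZeroFinset T, a ρ := by
  classical
  have e : ∑ ρ ∈ weilZeroFinset T, a ρ =
      ∑ z ∈ (weilZeroFinset T).map (Function.Embedding.subtype _), a z := by
    rw [Finset.sum_map]
    rfl
  rw [e, finsum_mem_eq_finite_toFinset_sum _ (weilZeroIndex_finite T)]
  refine Finset.sum_congr ?_ fun _ _ ↦ rfl
  ext z
  simp only [Set.Finite.mem_toFinset, Finset.mem_map, Function.Embedding.subtype_apply]
  constructor
  · intro hz
    have hz' : z ∈ RHWave0.riemannZetaNontrivialZeros := by rw [weilZeroIndex_eq_inter] at hz; exact hz.1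
    refine ⟨⟨z, hz'⟩, ?_, rfl⟩
    rw [mem_weilZeroFinset]
    rw [weilZeroIndex_eq_inter] at hz
    exact hz.2
  · rintro ⟨ρ, hρ, rfl⟩
    rw [weilZeroIndex_eq_inter]
    exact ⟨ρ.2, mem_weilZeroFinset.1 hρ⟩

/-! ### The contour identity at a good height -/

/-- **The contour identity.** Let `0 < δ ≤ 1/2` be such that all non-trivial zeros have
`|Im ρ| ≥ 2δ`, and let `T ≥ 2` be a height which is not `±` the ordinate of a zero. Then
`∮_{∂([1−T, T] × [−T, T])} (ξ'/ξ) g = 2πi ∑_{|Im ρ| ≤ T} m(ρ) g(ρ) + 4πi ξ'/ξ(1)`.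
[cite: Edwards1974, §3.8 (4) (here by residues)] -/
theorem contour_identity {δ T : ℝ} (hδ : 0 < δ) (hδ2 : δ ≤ 1 / 2)
    (hgap : ∀ ρ ∈ RHWave0.riemannZetaNontrivialZeros, 2 * δ ≤ |ρ.im|)
    (hT : 2 ≤ T) (hgood : ∀ ρ ∈ RHWave0.riemannZetaNontrivialZeros, ρ.im ≠ T ∧ ρ.im ≠ -T) :
    Literature.Analysis.Complex.rectBoundaryIntegral contourIntegrand (1 - T) T (-T) T =
      2 * π * I * ∑ ρ ∈ weilZeroFinset T, (riemannZetaZeroOrder (ρ : ℂ) : ℂ) * recipWeight ρ +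
        4 * π * I * logDeriv riemannXi 1 := by
  have ha : 1 - T < 0 := by linarith
  have hb : (1 : ℝ) < T := by linarith
  have hδT : δ < T := by linarith
  have hT0 : (0 : ℝ) < T := by linarith
  -- `ξ ≠ 0` near the real axis and at height `±T`
  have hξ_of_im : ∀ s : ℂ, |s.im| < 2 * δ → riemannXi s ≠ 0 := by
    intro s hs h0
    have hmem := mem_riemannZetaNontrivialZeros_of_riemannXi_eq_zero h0
    linarith [hgap s hmem]
  have hξ_T : ∀ s : ℂ, |s.im| = T → riemannXi s ≠ 0 := by
    intro s hs h0
    have hmem := mem_riemannZetaNontrivialZeros_of_riemannXi_eq_zero h0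
    obtain ⟨h1, h2⟩ := hgood s hmem
    rcases (abs_eq hT0.le).1 hs with h | h
    · exact h1 h
    · exact h2 h
  -- the integrand is continuous on the vertical lines `Re s = 1 - T` and `Re s = T`
  have hcontv : ∀ x : ℝ, (x = 1 - T ∨ x = T) → ∀ y : ℝ,
      ContinuousAt contourIntegrand ((x : ℂ) + y * I) := by
    intro x hx y
    refine continuousAt_contourIntegrand (riemannXi_ne_zero_of_re_not_mem ?_) ?_ ?_
    · simp only [add_re, ofReal_re, mul_re, I_re, mul_zero, ofReal_im, I_im, mul_one, sub_self,
        add_zero]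
      rcases hx with rfl | rfl
      · left; linarith
      · right; linarith
    · intro h; have := congrArg re h; simp at this; rcases hx with rfl | rfl <;> linarith
    · intro h; have := congrArg re h; simp at this; rcases hx with rfl | rfl <;> linarith
  have hii : ∀ x : ℝ, (x = 1 - T ∨ x = T) → ∀ c d : ℝ, c ≤ d →
      IntervalIntegrable (fun y : ℝ ↦ contourIntegrand ((x : ℂ) + y * I)) volume c d :=
    fun x hx c d hcd ↦
      Literature.Analysis.Complex.intervalIntegrable_of_continuousAt_vertical x hcd fun y _ ↦ hcontv x hx y
  -- cut the rectangle along `Im s = -δ` and `Im s = δ`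
  rw [rectBoundaryIntegral_split (e := -δ) (hii _ (Or.inl rfl) _ _ (by linarith))
      (hii _ (Or.inl rfl) _ _ (by linarith)) (hii _ (Or.inr rfl) _ _ (by linarith))
      (hii _ (Or.inr rfl) _ _ (by linarith)),
    rectBoundaryIntegral_split (c := -δ) (e := δ) (d := T) (hii _ (Or.inl rfl) _ _ (by linarith))
      (hii _ (Or.inl rfl) _ _ (by linarith)) (hii _ (Or.inr rfl) _ _ (by linarith))
      (hii _ (Or.inr rfl) _ _ (by linarith))]
  -- evaluate the three pieces
  have him_bot : ∀ x : ℝ, |((x : ℂ) + ((-T : ℝ) : ℂ) * I).im| = T := by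
    intro x; simp [abs_of_pos hT0]
  have him_top : ∀ x : ℝ, |((x : ℂ) + (T : ℂ) * I).im| = T := by
    intro x; simp [abs_of_pos hT0]
  have him_δ : ∀ x : ℝ, |((x : ℂ) + (δ : ℂ) * I).im| < 2 * δ := by
    intro x; simp [abs_of_pos hδ]; linarith
  have him_nδ : ∀ x : ℝ, |((x : ℂ) + ((-δ : ℝ) : ℂ) * I).im| < 2 * δ := by
    intro x; simp [abs_of_pos hδ]; linarith
  rw [rectBoundaryIntegral_outer ha.le hb.le (by linarith : -T < -δ) (Or.inr (by linarith))
      (fun x _ ↦ hξ_T _ (him_bot x)) (fun x _ ↦ hξ_of_im _ (him_nδ x)),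
    rectBoundaryIntegral_middle ha hb hδ (fun s hs ↦ hξ_of_im s (by
      have h := (Complex.mem_reProdIm.1 hs).2
      rw [abs_lt]; constructor <;> linarith [h.1, h.2])),
    rectBoundaryIntegral_outer ha.le hb.le hδT (Or.inl hδ)
      (fun x _ ↦ hξ_of_im _ (him_δ x)) (fun x _ ↦ hξ_T _ (him_top x))]
  -- the zero sets
  set f : ℂ → ℂ := fun ρ ↦ ((meromorphicOrderAt riemannXi ρ).untop₀ : ℂ) * recipWeight ρ with hf
  set Zp : Set ℂ := {ρ : ℂ | riemannXi ρ = 0 ∧ ρ ∈ Ioo (1 - T) T ×ℂ Ioo δ T} with hZp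
  set Zm : Set ℂ := {ρ : ℂ | riemannXi ρ = 0 ∧ ρ ∈ Ioo (1 - T) T ×ℂ Ioo (-T) (-δ)} with hZm
  have hunion : Zp ∪ Zm = weilZeroIndex T := by
    ext ρ
    simp only [hZp, hZm, mem_union, mem_setOf_eq, Complex.mem_reProdIm, mem_Ioo, weilZeroIndex]
    constructor
    · rintro (⟨h0, -, hi1, hi2⟩ | ⟨h0, -, hi1, hi2⟩)
      · obtain ⟨hζ, hre0, hre1, him⟩ := riemannXi_zero_prop h0
        exact ⟨hζ, hre0.le, hre1.le, him, abs_le.2 ⟨by linarith, hi2.le⟩⟩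
      · obtain ⟨hζ, hre0, hre1, him⟩ := riemannXi_zero_prop h0
        exact ⟨hζ, hre0.le, hre1.le, him, abs_le.2 ⟨hi1.le, by linarith⟩⟩
    · intro h
      have hmem : ρ ∈ RHWave0.riemannZetaNontrivialZeros :=
        ZetaZeros.riemannZetaNontrivialZeros.mem_of_im_ne_zero h.1 h.2.2.2.1
      have hξ0 := riemannXi_eq_zero_of_mem_riemannZetaNontrivialZeros hmem
      have hre0 := ZetaZeros.riemannZetaNontrivialZeros.re_pos hmem
      have hre1 := ZetaZeros.riemannZetaNontrivialZeros.re_lt_one hmem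
      have habs : |ρ.im| ≤ T := h.2.2.2.2
      obtain ⟨hne1, hne2⟩ := hgood ρ hmem
      have hlt1 : ρ.im < T := lt_of_le_of_ne (abs_le.1 habs).2 hne1
      have hlt2 : -T < ρ.im := lt_of_le_of_ne (abs_le.1 habs).1 (Ne.symm hne2)
      have hg := hgap ρ hmem
      have hre : 1 - T < ρ.re ∧ ρ.re < T := ⟨by linarith, by linarith⟩
      rcases le_or_gt 0 ρ.im with hi | hi
      · rw [abs_of_nonneg hi] at hg
        exact Or.inl ⟨hξ0, hre, by linarith, hlt1⟩
      · rw [abs_of_neg hi] at hg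
        exact Or.inr ⟨hξ0, hre, hlt2, by linarith⟩
  have hdisj : Disjoint Zp Zm := by
    rw [Set.disjoint_left]
    rintro ρ ⟨-, -, h1, -⟩ ⟨-, -, -, h2⟩
    linarith
  have hfin : (weilZeroIndex T).Finite := weilZeroIndex_finite T
  have hZpf : Zp.Finite := hfin.subset (hunion ▸ subset_union_left)
  have hZmf : Zm.Finite := hfin.subset (hunion ▸ subset_union_right)
  have hsum : ∑ᶠ ρ ∈ Zm, f ρ + ∑ᶠ ρ ∈ Zp, f ρ =
      ∑ ρ ∈ weilZeroFinset T, (riemannZetaZeroOrder (ρ : ℂ) : ℂ) * recipWeight ρ := by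
    rw [add_comm, ← finsum_mem_union hdisj hZpf hZmf, hunion,
      ← finsum_mem_weilZeroIndex_eq_sum (fun ρ ↦ (riemannZetaZeroOrder ρ : ℂ) * recipWeight ρ) T]
    refine finsum_mem_congr rfl fun ρ hρ ↦ ?_
    have hmem : ρ ∈ RHWave0.riemannZetaNontrivialZeros := by
      rw [weilZeroIndex_eq_inter] at hρ; exact hρ.1
    simp only [hf]
    rw [untop₀_meromorphicOrderAt_riemannXi (ZetaZeros.riemannZetaNontrivialZeros.re_pos hmem)
      (ZetaZeros.riemannZetaNontrivialZeros.ne_one hmem)]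
  change 2 * π * I * ∑ᶠ ρ ∈ Zm, f ρ + (4 * π * I * logDeriv riemannXi 1 + 2 * π * I * ∑ᶠ ρ ∈ Zp, f ρ) = _
  rw [← hsum]
  ring

/-! ### Absolute convergence of `∑ m(ρ) g(ρ)` -/

/-- `(Im ρ)² ≤ ‖ρ(1−ρ)‖` for `0 ≤ Re ρ ≤ 1` (`Re(ρ(1−ρ)) = Re ρ (1 − Re ρ) + (Im ρ)²`). [folklore] -/
theorem sq_im_le_norm_mul_one_sub {ρ : ℂ} (h0 : 0 ≤ ρ.re) (h1 : ρ.re ≤ 1) :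
    ρ.im ^ 2 ≤ ‖ρ * (1 - ρ)‖ := by
  have hre : (ρ * (1 - ρ)).re = ρ.re * (1 - ρ.re) + ρ.im ^ 2 := by
    simp only [mul_re, sub_re, one_re, sub_im, one_im, zero_sub, mul_neg]; ring
  calc ρ.im ^ 2 ≤ (ρ * (1 - ρ)).re := by rw [hre]; nlinarith
    _ ≤ ‖ρ * (1 - ρ)‖ := Complex.re_le_norm _

/-- With a gap `2δ ≤ |Im ρ|` (`0 < δ ≤ 1/2`): `‖g(ρ)‖ ≤ (2δ²)⁻¹/(1 + (Im ρ)²)` at a non-trivial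
zero. [folklore] -/
theorem norm_recipWeight_le_of_gap {δ : ℝ} (hδ : 0 < δ) (hδ2 : δ ≤ 1 / 2) {ρ : ℂ}
    (hρ : ρ ∈ RHWave0.riemannZetaNontrivialZeros) (hgap : 2 * δ ≤ |ρ.im|) :
    ‖recipWeight ρ‖ ≤ (1 / (2 * δ ^ 2)) / (1 + ρ.im ^ 2) := by
  rw [recipWeight_eq_neg, norm_neg, norm_div, norm_one, div_div]
  have him2 : 4 * δ ^ 2 ≤ ρ.im ^ 2 := by nlinarith [abs_nonneg ρ.im, sq_abs ρ.im]
  have h4 : 4 * δ ^ 2 ≤ 1 := by nlinarith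
  have hlow : 2 * δ ^ 2 * (1 + ρ.im ^ 2) ≤ ‖ρ * (1 - ρ)‖ := by
    have := sq_im_le_norm_mul_one_sub (ZetaZeros.riemannZetaNontrivialZeros.re_pos hρ).le
      (ZetaZeros.riemannZetaNontrivialZeros.re_lt_one hρ).le
    nlinarith [sq_nonneg ρ.im]
  exact one_div_le_one_div_of_le (by positivity) hlow

/-- Weight comparison: if `z` has the ordinate and the multiplicity of the non-trivial zero `ρ` and
`(Re z)² ≤ 1` then `m(ρ)/(1+γ²) ≤ m(z)/‖z‖²`. [folklore] -/
theorem div_one_add_sq_le_div_norm_sq {ρ z : ℂ} (h : ρ ∈ RHWave0.riemannZetaNontrivialZeros)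
    (him : z.im = ρ.im) (hre : z.re ^ 2 ≤ 1)
    (hm : riemannZetaZeroOrder z = riemannZetaZeroOrder ρ) :
    (riemannZetaZeroOrder ρ : ℝ) / (1 + ρ.im ^ 2) ≤ (riemannZetaZeroOrder z : ℝ) / ‖z‖ ^ 2 := by
  have hm0 : (0 : ℝ) ≤ riemannZetaZeroOrder ρ := by
    exact_mod_cast riemannZetaZeroOrder_nonneg (ZetaZeros.riemannZetaNontrivialZeros.ne_one h)
  have hz : z ≠ 0 := by
    intro hz
    rw [hz, Complex.zero_im] at him
    exact ZetaZeros.riemannZetaNontrivialZeros.im_ne_zero h him.symm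
  have hz2 : 0 < ‖z‖ ^ 2 := by positivity
  rw [hm]
  refine div_le_div_of_nonneg_left hm0 hz2 ?_
  rw [← Complex.normSq_eq_norm_sq, Complex.normSq_apply, him]
  nlinarith

/-- **`∑_ρ m(ρ)/(1 + γ²) < ∞`** over the non-trivial zeros (unconditional; from
`Literature.NumberTheory.LFunctions.summable_zeroOrder_div_norm_sq`, Jensen's count, exactly as `Literature.NumberTheory.LFunctions.weilZeroSummable`, the
zeros with `Re ρ < 1/4` being reflected by `ρ ↦ 1 − ρ̄`).
[cite: Titchmarsh1986, §9.2, Thm. 9.2] -/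
theorem summable_zeroOrder_div_one_add_sq :
    Summable fun ρ : RHWave0.riemannZetaNontrivialZeros ↦
      (riemannZetaZeroOrder (ρ : ℂ) : ℝ) / (1 + (ρ : ℂ).im ^ 2) := by
  have hG := summable_zeroOrder_div_norm_sq
  have hζ : ∀ ρ : RHWave0.riemannZetaNontrivialZeros, riemannZeta ρ = 0 := fun ρ ↦
    ZetaZeros.riemannZetaNontrivialZeros.zeta_eq_zero ρ.2
  have hnn : ∀ ρ : RHWave0.riemannZetaNontrivialZeros,
      0 ≤ (riemannZetaZeroOrder (ρ : ℂ) : ℝ) / (1 + (ρ : ℂ).im ^ 2) := by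
    intro ρ
    have h0 : (0 : ℝ) ≤ riemannZetaZeroOrder (ρ : ℂ) := by
      exact_mod_cast riemannZetaZeroOrder_nonneg (ZetaZeros.riemannZetaNontrivialZeros.ne_one ρ.2)
    positivity
  set s : Set RHWave0.riemannZetaNontrivialZeros := {ρ | 1 / 4 ≤ (ρ : ℂ).re} with hs
  refine (summable_subtype_and_compl (s := s)).1 ⟨?_, ?_⟩
  · let i₁ : s → zetaZerosRight := fun ρ ↦
      ⟨((ρ : RHWave0.riemannZetaNontrivialZeros) : ℂ), hζ (ρ : RHWave0.riemannZetaNontrivialZeros), ρ.2⟩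
    have hi₁ : Function.Injective i₁ := by
      intro a b hab
      have h := congrArg Subtype.val hab
      exact Subtype.ext (Subtype.ext h)
    refine Summable.of_nonneg_of_le (fun ρ ↦ hnn _) (fun ρ ↦ ?_) (hG.comp_injective hi₁)
    have h1 : ((ρ : RHWave0.riemannZetaNontrivialZeros) : ℂ).re ^ 2 ≤ 1 := by
      have h0 := ZetaZeros.riemannZetaNontrivialZeros.re_pos (ρ : RHWave0.riemannZetaNontrivialZeros).2
      have h1 := ZetaZeros.riemannZetaNontrivialZeros.re_lt_one (ρ : RHWave0.riemannZetaNontrivialZeros).2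
      nlinarith
    exact div_one_add_sq_le_div_norm_sq (ρ : RHWave0.riemannZetaNontrivialZeros).2 rfl h1 rfl
  · have hmem : ∀ ρ : ↥sᶜ, riemannZeta (1 - conj ((ρ : RHWave0.riemannZetaNontrivialZeros) : ℂ)) = 0 ∧
        1 / 4 ≤ (1 - conj ((ρ : RHWave0.riemannZetaNontrivialZeros) : ℂ)).re := by
      intro ρ
      have hρ := (ρ : RHWave0.riemannZetaNontrivialZeros).2
      have hlt : ¬ 1 / 4 ≤ ((ρ : RHWave0.riemannZetaNontrivialZeros) : ℂ).re := ρ.2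
      refine ⟨ZetaZeros.riemannZetaNontrivialZeros.zeta_eq_zero
        (ZetaZeros.riemannZetaNontrivialZeros.one_sub_conj_mem hρ), ?_⟩
      simp only [sub_re, one_re, conj_re]
      linarith
    let i₂ : ↥sᶜ → zetaZerosRight := fun ρ ↦
      ⟨1 - conj ((ρ : RHWave0.riemannZetaNontrivialZeros) : ℂ), hmem ρ⟩
    have hi₂ : Function.Injective i₂ := by
      intro a b hab
      have h : 1 - conj ((a : RHWave0.riemannZetaNontrivialZeros) : ℂ) =
          1 - conj ((b : RHWave0.riemannZetaNontrivialZeros) : ℂ) := by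
        have := congrArg Subtype.val hab
        exact this
      have h' :
          ((a : RHWave0.riemannZetaNontrivialZeros) : ℂ) = ((b : RHWave0.riemannZetaNontrivialZeros) : ℂ) := by
        have := congrArg conj (sub_right_injective h)
        simpa using this
      exact Subtype.ext (Subtype.ext h')
    refine Summable.of_nonneg_of_le (fun ρ ↦ hnn _) (fun ρ ↦ ?_) (hG.comp_injective hi₂)
    have hρ := (ρ : RHWave0.riemannZetaNontrivialZeros).2
    have h0 := ZetaZeros.riemannZetaNontrivialZeros.re_pos hρ
    have h1 := ZetaZeros.riemannZetaNontrivialZeros.re_lt_one hρ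
    refine div_one_add_sq_le_div_norm_sq hρ (by simp [i₂]) ?_
      (riemannZetaZeroOrder_one_sub_conj h0 h1)
    simp only [i₂, sub_re, one_re, conj_re]
    nlinarith

/-- **Absolute convergence**: `∑_ρ ‖m(ρ) g(ρ)‖ < ∞` (`‖g(ρ)‖ ≪ 1/(1 + γ²)` by the gap
`exists_gap_im`). [folklore] -/
theorem summable_norm_zeroOrder_mul_recipWeight :
    Summable fun ρ : RHWave0.riemannZetaNontrivialZeros ↦
      ‖(riemannZetaZeroOrder (ρ : ℂ) : ℂ) * recipWeight ρ‖ := by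
  obtain ⟨δ, hδ, hδ2, hgap⟩ := exists_gap_im
  refine Summable.of_nonneg_of_le (fun _ ↦ norm_nonneg _) (fun ρ ↦ ?_)
    (summable_zeroOrder_div_one_add_sq.mul_left (1 / (2 * δ ^ 2)))
  have hm : (0 : ℝ) ≤ riemannZetaZeroOrder (ρ : ℂ) := by
    exact_mod_cast riemannZetaZeroOrder_nonneg (ZetaZeros.riemannZetaNontrivialZeros.ne_one ρ.2)
  rw [norm_mul, Complex.norm_intCast, abs_of_nonneg hm]
  calc (riemannZetaZeroOrder (ρ : ℂ) : ℝ) * ‖recipWeight ρ‖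
      ≤ (riemannZetaZeroOrder (ρ : ℂ) : ℝ) * ((1 / (2 * δ ^ 2)) / (1 + (ρ : ℂ).im ^ 2)) :=
        mul_le_mul_of_nonneg_left (norm_recipWeight_le_of_gap hδ hδ2 ρ.2 (hgap _ ρ.2)) hm
    _ = 1 / (2 * δ ^ 2) * ((riemannZetaZeroOrder (ρ : ℂ) : ℝ) / (1 + (ρ : ℂ).im ^ 2)) := by ring

/-! ### Bounds for the integrand on the boundary of `[1−T, T] × [−T, T]` -/

section Bounds

variable {Ch Cr : ℝ}
  (hCh : ∀ (t η : ℝ), 2 ≤ |t| → 0 < η → η ≤ 1 →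
      (∀ ρ : ℂ, riemannZeta ρ = 0 → 0 < ρ.re → η ≤ |ρ.im - t|) →
      ∀ σ : ℝ, σ ∈ Icc (-(1 / 2) : ℝ) (3 / 2) →
        ‖logDeriv riemannXi (σ + t * I)‖ ≤ Ch * Real.log (|t| + 4) / η)
  (hCr : ∀ s : ℂ, 3 / 2 ≤ s.re →
      ‖logDeriv riemannXi s‖ ≤ Cr + ‖s‖ ∧
        (1 ≤ |s.im| → ‖logDeriv riemannXi s‖ ≤ Cr + Real.log (1 + ‖s‖)))

include hCr in
/-- On `Re s ≥ 3/2`, `|Im s| ≥ 1`, `‖s‖ ≤ 2T`: `‖ξ'/ξ(s)‖ ≤ C_r + log(1 + 2T)`. [folklore] -/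
theorem norm_logDeriv_le_of_re_ge_of_norm_le {s : ℂ} {T : ℝ} (hre : 3 / 2 ≤ s.re)
    (him : 1 ≤ |s.im|) (hs : ‖s‖ ≤ 2 * T) :
    ‖logDeriv riemannXi s‖ ≤ Cr + Real.log (1 + 2 * T) := by
  have h := (hCr s hre).2 him
  have hlog : Real.log (1 + ‖s‖) ≤ Real.log (1 + 2 * T) :=
    Real.log_le_log (by positivity) (by linarith)
  linarith

include hCh hCr in
/-- **The horizontal sides, pointwise**: at a height `t = ±T` (`T ≥ 2`) which is `η`-separated
from the ordinates (`0 < η ≤ 1`), for every `x ∈ [1−T, T]`,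
`‖ξ'/ξ(x + it)‖ ≤ C_h log(T+4)/η + C_r + log(1 + 2T)` (the strip `[−1/2, 3/2]` by the tree's bound,
`x ≥ 3/2` by the right half-plane bound, `x ≤ −1/2` by reflection). [cite: Bombieri2000Weil, §2] -/
theorem norm_logDeriv_horizontal_le (hCh0 : 0 ≤ Ch) (hCr0 : 0 ≤ Cr) {T η t : ℝ} (hT : 2 ≤ T)
    (ht : t = T ∨ t = -T) (hη : 0 < η) (hη1 : η ≤ 1)
    (hsep : ∀ ρ ∈ RHWave0.riemannZetaNontrivialZeros, η ≤ |ρ.im - t|) {x : ℝ} (hx : x ∈ Icc (1 - T) T) :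
    ‖logDeriv riemannXi (x + t * I)‖ ≤
      Ch * Real.log (T + 4) / η + (Cr + Real.log (1 + 2 * T)) := by
  have hT0 : 0 < T := by linarith
  have htabs : |t| = T := by
    rcases ht with rfl | rfl
    · exact abs_of_pos hT0
    · rw [abs_neg]; exact abs_of_pos hT0
  have hsep' : ∀ ρ : ℂ, riemannZeta ρ = 0 → 0 < ρ.re → η ≤ |ρ.im - t| := fun ρ hz h0 ↦
    hsep ρ (ZetaZeros.riemannZetaNontrivialZeros.mem_of_re_pos hz h0)
  have hlog4 : 0 ≤ Real.log (T + 4) := Real.log_nonneg (by linarith)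
  have hlog2 : 0 ≤ Real.log (1 + 2 * T) := Real.log_nonneg (by linarith)
  have h1nn : 0 ≤ Ch * Real.log (T + 4) / η := by positivity
  have hright : ∀ u : ℝ, 3 / 2 ≤ u → u ≤ T →
      ‖logDeriv riemannXi (u + t * I)‖ ≤ Cr + Real.log (1 + 2 * T) := by
    intro u hu huT
    refine norm_logDeriv_le_of_re_ge_of_norm_le hCr (by simpa using hu) ?_ ?_
    · simp [htabs]; linarith
    · calc ‖(u : ℂ) + t * I‖ ≤ ‖(u : ℂ)‖ + ‖(t : ℂ) * I‖ := norm_add_le _ _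
        _ = |u| + |t| := by simp
        _ ≤ 2 * T := by rw [htabs, abs_of_pos (by linarith : (0 : ℝ) < u)]; linarith
  rcases lt_or_ge x (-(1 / 2)) with h₁ | h₁
  · -- reflect
    rw [norm_logDeriv_riemannXi_reflect]
    have := hright (1 - x) (by linarith) (by linarith [hx.1])
    linarith
  rcases le_or_gt x (3 / 2) with h₂ | h₂
  · have := hCh t η (by rw [htabs]; exact hT) hη hη1 hsep' x ⟨h₁, h₂⟩
    rw [htabs] at this
    linarith
  · have := hright x h₂.le hx.2
    linarith

/-- On the horizontal sides `|g| ≤ 1/T²`: for `Im s = ±T`, `‖s‖, ‖s − 1‖ ≥ T`. [folklore] -/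
theorem norm_recipWeight_le_horizontal {x t T : ℝ} (hT : 0 < T) (ht : t = T ∨ t = -T) :
    ‖recipWeight (x + t * I)‖ ≤ 1 / T ^ 2 := by
  have htabs : |t| = T := by
    rcases ht with rfl | rfl
    · exact abs_of_pos hT
    · rw [abs_neg]; exact abs_of_pos hT
  rw [norm_recipWeight]
  have h1 : T ≤ ‖(x : ℂ) + t * I‖ := by
    have := Complex.abs_im_le_norm ((x : ℂ) + t * I)
    simpa [htabs] using this
  have h2 : T ≤ ‖(x : ℂ) + t * I - 1‖ := by
    have := Complex.abs_im_le_norm ((x : ℂ) + t * I - 1)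
    simpa [htabs] using this
  rw [sq]
  exact one_div_le_one_div_of_le (by positivity) (mul_le_mul h1 h2 hT.le (norm_nonneg _))

include hCh hCr in
/-- **The horizontal sides**: `‖∫_{1−T}^{T} (ξ'/ξ g)(x ± iT) dx‖ ≤ (2T−1)·K_h/T²`,
`K_h = C_h log(T+4)/η + C_r + log(1+2T)`. [cite: Bombieri2000Weil, §2] -/
theorem norm_horizontal_le (hCh0 : 0 ≤ Ch) (hCr0 : 0 ≤ Cr) {T η t : ℝ} (hT : 2 ≤ T)
    (ht : t = T ∨ t = -T) (hη : 0 < η) (hη1 : η ≤ 1)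
    (hsep : ∀ ρ ∈ RHWave0.riemannZetaNontrivialZeros, η ≤ |ρ.im - t|) :
    ‖∫ x : ℝ in (1 - T)..T, contourIntegrand (x + t * I)‖ ≤
      (Ch * Real.log (T + 4) / η + (Cr + Real.log (1 + 2 * T))) / T ^ 2 * (2 * T - 1) := by
  have hT0 : 0 < T := by linarith
  have h := intervalIntegral.norm_integral_le_of_norm_le_const (a := 1 - T) (b := T)
    (C := (Ch * Real.log (T + 4) / η + (Cr + Real.log (1 + 2 * T))) / T ^ 2)
    (f := fun x : ℝ ↦ contourIntegrand (x + t * I)) ?_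
  · rwa [show |T - (1 - T)| = 2 * T - 1 by rw [abs_of_pos (by linarith)]; ring] at h
  intro x hx
  rw [uIoc_of_le (by linarith)] at hx
  have hx' : x ∈ Icc (1 - T) T := ⟨hx.1.le, hx.2⟩
  rw [contourIntegrand, norm_mul, div_eq_mul_one_div]
  have hK : 0 ≤ Ch * Real.log (T + 4) / η + (Cr + Real.log (1 + 2 * T)) := by
    have : 0 ≤ Real.log (T + 4) := Real.log_nonneg (by linarith)
    have : 0 ≤ Real.log (1 + 2 * T) := Real.log_nonneg (by linarith)
    positivity
  exact mul_le_mul (norm_logDeriv_horizontal_le hCh hCr hCh0 hCr0 hT ht hη hη1 hsep hx')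
    (norm_recipWeight_le_horizontal hT0 ht) (norm_nonneg _) hK

/-- On the vertical sides `|g| ≤ 2/T²`: for `Re s ∈ {1−T, T}`, `T ≥ 2`, one of `‖s‖, ‖s−1‖` is
`≥ T` and the other `≥ T − 1 ≥ T/2`. [folklore] -/
theorem norm_recipWeight_le_vertical {x y T : ℝ} (hT : 2 ≤ T) (hx : x = T ∨ x = 1 - T) :
    ‖recipWeight (x + y * I)‖ ≤ 2 / T ^ 2 := by
  rw [norm_recipWeight]
  have hre1 : |x| ≤ ‖(x : ℂ) + y * I‖ := by
    have := Complex.abs_re_le_norm ((x : ℂ) + y * I); simpa using this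
  have hre2 : |x - 1| ≤ ‖(x : ℂ) + y * I - 1‖ := by
    have := Complex.abs_re_le_norm ((x : ℂ) + y * I - 1); simpa using this
  have hprod : T ^ 2 / 2 ≤ ‖(x : ℂ) + y * I‖ * ‖(x : ℂ) + y * I - 1‖ := by
    rcases hx with hx | hx <;> rw [hx] at hre1 hre2 ⊢
    · rw [abs_of_pos (by linarith)] at hre1
      rw [abs_of_pos (by linarith)] at hre2
      calc T ^ 2 / 2 ≤ T * (T - 1) := by nlinarith
        _ ≤ _ := mul_le_mul hre1 hre2 (by linarith) (norm_nonneg _)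
    · have e1 : |1 - T| = T - 1 := by rw [abs_sub_comm]; exact abs_of_pos (by linarith)
      have e2 : |1 - T - 1| = T := by
        rw [show (1 - T - 1 : ℝ) = -T by ring, abs_neg, abs_of_pos (by linarith)]
      rw [e1] at hre1
      rw [e2] at hre2
      calc T ^ 2 / 2 ≤ (T - 1) * T := by nlinarith
        _ ≤ _ := mul_le_mul hre1 hre2 (by linarith) (norm_nonneg _)
  calc 1 / (‖(x : ℂ) + y * I‖ * ‖(x : ℂ) + y * I - 1‖) ≤ 1 / (T ^ 2 / 2) :=
        one_div_le_one_div_of_le (by positivity) hprod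
    _ = 2 / T ^ 2 := by field_simp

include hCr in
/-- **The vertical sides, pointwise**: for `Re s ∈ {1−T, T}` (`T ≥ 2`) and `|y| ≤ T`,
`‖(ξ'/ξ g)(x+iy)‖ ≤ (C_r + log(1+2T))·2/T²` if `|y| ≥ 1` and `≤ (C_r + 2T)·2/T²` in general (the
left side is reflected onto the right one). [cite: Bombieri2000Weil, §2] -/
theorem norm_contourIntegrand_vertical_le (hCr0 : 0 ≤ Cr) {x y T : ℝ} (hT : 2 ≤ T)
    (hx : x = T ∨ x = 1 - T) (hy : |y| ≤ T) :
    ‖contourIntegrand (x + y * I)‖ ≤ (Cr + 2 * T) * (2 / T ^ 2) ∧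
      (1 ≤ |y| → ‖contourIntegrand (x + y * I)‖ ≤ (Cr + Real.log (1 + 2 * T)) * (2 / T ^ 2)) := by
  -- reduce the `ξ'/ξ` factor to the right side `Re s = T`
  have hL : ‖logDeriv riemannXi (x + y * I)‖ = ‖logDeriv riemannXi (T + y * I)‖ := by
    rcases hx with rfl | rfl
    · rfl
    · rw [norm_logDeriv_riemannXi_reflect]
      congr 2
      push_cast
      ring
  have hre : 3 / 2 ≤ ((T : ℂ) + y * I).re := by simp; linarith
  have hnorm : ‖(T : ℂ) + y * I‖ ≤ 2 * T := by
    calc ‖(T : ℂ) + y * I‖ ≤ ‖(T : ℂ)‖ + ‖(y : ℂ) * I‖ := norm_add_le _ _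
      _ = |T| + |y| := by simp
      _ ≤ 2 * T := by rw [abs_of_pos (by linarith)]; linarith
  have hg := norm_recipWeight_le_vertical (y := y) hT hx
  have hg0 : 0 ≤ ‖recipWeight (x + y * I)‖ := norm_nonneg _
  rw [contourIntegrand, norm_mul, hL]
  constructor
  · have h1 : ‖logDeriv riemannXi (T + y * I)‖ ≤ Cr + 2 * T :=
      ((hCr _ hre).1).trans (by linarith)
    exact mul_le_mul h1 hg hg0 (by linarith)
  · intro hy1
    have h1 : ‖logDeriv riemannXi (T + y * I)‖ ≤ Cr + Real.log (1 + 2 * T) :=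
      norm_logDeriv_le_of_re_ge_of_norm_le hCr hre (by simpa using hy1) hnorm
    have : 0 ≤ Real.log (1 + 2 * T) := Real.log_nonneg (by linarith)
    exact mul_le_mul h1 hg hg0 (by linarith)

/-- The integrand is continuous on the vertical lines `Re s = T` and `Re s = 1 − T` (`T > 1`).
[folklore] -/
theorem continuousAt_contourIntegrand_vertical {x T : ℝ} (hT : 1 < T) (hx : x = T ∨ x = 1 - T)
    (y : ℝ) : ContinuousAt contourIntegrand ((x : ℂ) + y * I) := by
  refine continuousAt_contourIntegrand (riemannXi_ne_zero_of_re_not_mem ?_) ?_ ?_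
  · simp only [add_re, ofReal_re, mul_re, I_re, mul_zero, ofReal_im, I_im, mul_one, sub_self,
      add_zero]
    rcases hx with rfl | rfl
    · right; linarith
    · left; linarith
  · intro h; have := congrArg re h; simp at this; rcases hx with rfl | rfl <;> linarith
  · intro h; have := congrArg re h; simp at this; rcases hx with rfl | rfl <;> linarith

include hCr in
/-- **The vertical sides**: for `x ∈ {1−T, T}`, `T ≥ 2`,
`‖∫_{−T}^{T} (ξ'/ξ g)(x+iy) dy‖ ≤ 4(C_r + log(1+2T))/T + 4C_r/T² + 8/T` (split at `y = ±1`).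
[cite: Bombieri2000Weil, §2] -/
theorem norm_vertical_le (hCr0 : 0 ≤ Cr) {x T : ℝ} (hT : 2 ≤ T) (hx : x = T ∨ x = 1 - T) :
    ‖∫ y : ℝ in (-T)..T, contourIntegrand (x + y * I)‖ ≤
      4 * (Cr + Real.log (1 + 2 * T)) / T + (4 * Cr / T ^ 2 + 8 / T) := by
  have hT0 : 0 < T := by linarith
  have hii : ∀ c d : ℝ, c ≤ d → IntervalIntegrable (fun y : ℝ ↦ contourIntegrand ((x : ℂ) + y * I))
      volume c d := fun c d hcd ↦
    Literature.Analysis.Complex.intervalIntegrable_of_continuousAt_vertical x hcd fun y _ ↦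
      continuousAt_contourIntegrand_vertical (by linarith) hx y
  rw [← integral_add_adjacent_intervals (hii (-T) (-1) (by linarith)) (hii (-1) T (by linarith)),
    ← integral_add_adjacent_intervals (hii (-1) 1 (by linarith)) (hii 1 T (by linarith))]
  set K₁ := (Cr + Real.log (1 + 2 * T)) * (2 / T ^ 2) with hK₁
  set K₀ := (Cr + 2 * T) * (2 / T ^ 2) with hK₀
  have hb1 : ‖∫ y : ℝ in (-T)..(-1), contourIntegrand (x + y * I)‖ ≤ K₁ * |(-1) - (-T)| := by
    refine intervalIntegral.norm_integral_le_of_norm_le_const fun y hy ↦ ?_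
    rw [uIoc_of_le (by linarith)] at hy
    exact (norm_contourIntegrand_vertical_le hCr hCr0 hT hx
      (by rw [abs_le]; constructor <;> linarith [hy.1, hy.2])).2
      (by rw [le_abs]; right; linarith [hy.2])
  have hb2 : ‖∫ y : ℝ in (-1)..1, contourIntegrand (x + y * I)‖ ≤ K₀ * |1 - (-1)| := by
    refine intervalIntegral.norm_integral_le_of_norm_le_const fun y hy ↦ ?_
    rw [uIoc_of_le (by linarith)] at hy
    exact (norm_contourIntegrand_vertical_le hCr hCr0 hT hx
      (by rw [abs_le]; constructor <;> linarith [hy.1, hy.2])).1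
  have hb3 : ‖∫ y : ℝ in (1 : ℝ)..T, contourIntegrand (x + y * I)‖ ≤ K₁ * |T - 1| := by
    refine intervalIntegral.norm_integral_le_of_norm_le_const fun y hy ↦ ?_
    rw [uIoc_of_le (by linarith)] at hy
    exact (norm_contourIntegrand_vertical_le hCr hCr0 hT hx
      (by rw [abs_le]; constructor <;> linarith [hy.1, hy.2])).2
      (by rw [le_abs]; left; linarith [hy.1])
  have e1 : |(-1 : ℝ) - -T| = T - 1 := by
    rw [show (-1 : ℝ) - -T = T - 1 by ring]; exact abs_of_pos (by linarith)
  have e2 : |(1 : ℝ) - -1| = 2 := by norm_num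
  rw [e1] at hb1
  rw [e2] at hb2
  rw [abs_of_pos (by linarith : (0 : ℝ) < T - 1)] at hb3
  have hlog : 0 ≤ Real.log (1 + 2 * T) := Real.log_nonneg (by linarith)
  have hK₁0 : 0 ≤ K₁ := by positivity
  calc _ ≤ ‖∫ y : ℝ in (-T)..(-1), contourIntegrand (x + y * I)‖ +
        ‖(∫ y : ℝ in (-1)..1, contourIntegrand (x + y * I)) +
          ∫ y : ℝ in (1 : ℝ)..T, contourIntegrand (x + y * I)‖ := norm_add_le _ _
    _ ≤ K₁ * (T - 1) + K₀ * 2 + K₁ * (T - 1) := by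
        linarith [norm_add_le (∫ y : ℝ in (-1)..1, contourIntegrand (x + y * I))
          (∫ y : ℝ in (1 : ℝ)..T, contourIntegrand (x + y * I))]
    _ ≤ K₁ * T + K₀ * 2 + K₁ * T := by nlinarith
    _ = 4 * (Cr + Real.log (1 + 2 * T)) / T + (4 * Cr / T ^ 2 + 8 / T) := by
        rw [hK₁, hK₀]; field_simp; ring

include hCh hCr in
/-- **The whole boundary** at a good height: with `K_h = C_h log(T+4)/η + C_r + log(1+2T)`,
`‖∮_{∂([1−T,T]×[−T,T])} (ξ'/ξ) g‖ ≤ 2(2T−1)K_h/T² + 2(4(C_r + log(1+2T))/T + 4C_r/T² + 8/T)`.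
[cite: Bombieri2000Weil, §2] -/
theorem norm_rectBoundaryIntegral_le (hCh0 : 0 ≤ Ch) (hCr0 : 0 ≤ Cr) {T η : ℝ} (hT : 2 ≤ T)
    (hη : 0 < η) (hη1 : η ≤ 1)
    (hsep : ∀ ρ ∈ RHWave0.riemannZetaNontrivialZeros, η ≤ |ρ.im - T|) :
    ‖Literature.Analysis.Complex.rectBoundaryIntegral contourIntegrand (1 - T) T (-T) T‖ ≤
      2 * ((Ch * Real.log (T + 4) / η + (Cr + Real.log (1 + 2 * T))) / T ^ 2 * (2 * T - 1)) +
        2 * (4 * (Cr + Real.log (1 + 2 * T)) / T + (4 * Cr / T ^ 2 + 8 / T)) := by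
  -- separation from `-T` as well (conjugate zeros)
  have hsep' : ∀ ρ ∈ RHWave0.riemannZetaNontrivialZeros, η ≤ |ρ.im - (-T)| := by
    intro ρ hρ
    have h := hsep _ (ZetaZeros.riemannZetaNontrivialZeros.conj_mem hρ)
    rw [conj_im] at h
    rwa [show |ρ.im - (-T)| = |-ρ.im - T| by
      rw [show -ρ.im - T = -(ρ.im - (-T)) by ring, abs_neg]]
  have h1 := norm_horizontal_le hCh hCr hCh0 hCr0 hT (Or.inr rfl) hη hη1 hsep'
  have h2 := norm_horizontal_le hCh hCr hCh0 hCr0 hT (Or.inl rfl) hη hη1 hsep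
  have h3 := norm_vertical_le hCr hCr0 hT (Or.inl rfl)
  have h4 := norm_vertical_le hCr hCr0 hT (Or.inr rfl)
  rw [Literature.Analysis.Complex.rectBoundaryIntegral]
  have hI : ∀ z : ℂ, ‖I * z‖ = ‖z‖ := fun z ↦ by simp
  calc _ ≤ ‖(∫ x : ℝ in (1 - T)..T, contourIntegrand (x + (-T : ℝ) * I)) -
            (∫ x : ℝ in (1 - T)..T, contourIntegrand (x + T * I)) +
            I * ∫ y : ℝ in (-T)..T, contourIntegrand (T + y * I)‖ +
          ‖I * ∫ y : ℝ in (-T)..T, contourIntegrand ((1 - T : ℝ) + y * I)‖ := norm_sub_le _ _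
    _ ≤ ‖(∫ x : ℝ in (1 - T)..T, contourIntegrand (x + (-T : ℝ) * I)) -
            (∫ x : ℝ in (1 - T)..T, contourIntegrand (x + T * I))‖ +
            ‖I * ∫ y : ℝ in (-T)..T, contourIntegrand (T + y * I)‖ +
          ‖I * ∫ y : ℝ in (-T)..T, contourIntegrand ((1 - T : ℝ) + y * I)‖ := by
        gcongr; exact norm_add_le _ _
    _ ≤ ‖∫ x : ℝ in (1 - T)..T, contourIntegrand (x + (-T : ℝ) * I)‖ +
            ‖∫ x : ℝ in (1 - T)..T, contourIntegrand (x + T * I)‖ +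
            ‖∫ y : ℝ in (-T)..T, contourIntegrand (T + y * I)‖ +
          ‖∫ y : ℝ in (-T)..T, contourIntegrand ((1 - T : ℝ) + y * I)‖ := by
        rw [hI, hI]; gcongr; exact norm_sub_le _ _
    _ ≤ _ := by linarith

end Bounds

/-! ### The limit along the good heights -/

/-- `log²(n+7)/n → 0`. [folklore] -/
theorem tendsto_log_sq_div : Tendsto (fun n : ℕ ↦ Real.log ((n : ℝ) + 7) ^ 2 / n) atTop (𝓝 0) := by
  have h := Real.tendsto_pow_log_div_mul_add_atTop 1 (-7) 2 one_ne_zero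
  have h2 : Tendsto (fun n : ℕ ↦ (n : ℝ) + 7) atTop atTop :=
    tendsto_atTop_add_const_right _ _ tendsto_natCast_atTop_atTop
  refine (h.comp h2).congr fun n ↦ ?_
  simp

/-- The elementary bookkeeping: for `N ≥ 2`, `T ∈ [N, N+1]`, `1/η ≤ A log(N+6)`, the bound of
`norm_rectBoundaryIntegral_le` is `≤ (4 C_h A + 20 C_r + 40) log²(N+7)/N`. [folklore] -/
theorem boundary_bound_le {Ch Cr A T η : ℝ} {N : ℕ} (hCh0 : 0 ≤ Ch) (hCr0 : 0 ≤ Cr) (hA0 : 0 ≤ A)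
    (hN : 2 ≤ N) (hTN : (N : ℝ) ≤ T) (hTN1 : T ≤ N + 1) (hη : 0 < η)
    (hηA : 1 / η ≤ A * Real.log (N + 6)) :
    2 * ((Ch * Real.log (T + 4) / η + (Cr + Real.log (1 + 2 * T))) / T ^ 2 * (2 * T - 1)) +
        2 * (4 * (Cr + Real.log (1 + 2 * T)) / T + (4 * Cr / T ^ 2 + 8 / T)) ≤
      (4 * Ch * A + 20 * Cr + 40) * (Real.log ((N : ℝ) + 7) ^ 2 / N) := by
  have hN2 : (2 : ℝ) ≤ N := by exact_mod_cast hN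
  have hT2 : 2 ≤ T := by linarith
  have hT0 : 0 < T := by linarith
  have hN0 : (0 : ℝ) < N := by linarith
  set ℓ := Real.log ((N : ℝ) + 7) with hℓ
  have hℓ1 : 1 ≤ ℓ := by
    rw [hℓ, Real.le_log_iff_exp_le (by positivity)]
    linarith [Real.exp_one_lt_d9]
  have hℓ0 : 0 ≤ ℓ := by linarith
  have hℓsq : ℓ ≤ ℓ ^ 2 := by nlinarith
  have hlog4 : Real.log (T + 4) ≤ ℓ := Real.log_le_log (by linarith) (by linarith)
  have hlog40 : 0 ≤ Real.log (T + 4) := Real.log_nonneg (by linarith)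
  have hlog6 : Real.log ((N : ℝ) + 6) ≤ ℓ := Real.log_le_log (by linarith) (by linarith)
  have hlog2T : Real.log (1 + 2 * T) ≤ 2 * ℓ := by
    rw [hℓ, ← Real.log_rpow (by linarith), show ((N : ℝ) + 7) ^ (2 : ℝ) = ((N : ℝ) + 7) ^ 2 by
      norm_cast]
    exact Real.log_le_log (by linarith) (by nlinarith)
  have hlog2T0 : 0 ≤ Real.log (1 + 2 * T) := Real.log_nonneg (by linarith)
  have h1η : 1 / η ≤ A * ℓ := hηA.trans (mul_le_mul_of_nonneg_left hlog6 hA0)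
  -- the pieces
  have e1 : Ch * Real.log (T + 4) / η ≤ Ch * A * ℓ ^ 2 := by
    calc Ch * Real.log (T + 4) / η = Ch * Real.log (T + 4) * (1 / η) := by ring
      _ ≤ Ch * ℓ * (A * ℓ) :=
          mul_le_mul (mul_le_mul_of_nonneg_left hlog4 hCh0) h1η (by positivity) (by positivity)
      _ = Ch * A * ℓ ^ 2 := by ring
  have e2 : Cr + Real.log (1 + 2 * T) ≤ (Cr + 2) * ℓ ^ 2 := by nlinarith
  have e3 : (2 * T - 1) / T ^ 2 ≤ 2 / N := by
    rw [div_le_div_iff₀ (by positivity) hN0]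
    nlinarith
  have e30 : 0 ≤ (2 * T - 1) / T ^ 2 := div_nonneg (by linarith) (by positivity)
  have t1 : (Ch * Real.log (T + 4) / η + (Cr + Real.log (1 + 2 * T))) / T ^ 2 * (2 * T - 1) ≤
      (Ch * A + Cr + 2) * ℓ ^ 2 * (2 / N) := by
    rw [show (Ch * Real.log (T + 4) / η + (Cr + Real.log (1 + 2 * T))) / T ^ 2 * (2 * T - 1) =
      (Ch * Real.log (T + 4) / η + (Cr + Real.log (1 + 2 * T))) * ((2 * T - 1) / T ^ 2) by ring]
    refine mul_le_mul (by nlinarith) e3 e30 (by positivity)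
  have t2 : 4 * (Cr + Real.log (1 + 2 * T)) / T ≤ 4 * ((Cr + 2) * ℓ ^ 2) / N := by
    rw [mul_div_assoc, mul_div_assoc]
    refine mul_le_mul_of_nonneg_left ?_ (by norm_num)
    exact div_le_div₀ (by positivity) e2 hN0 hTN
  have t3 : 4 * Cr / T ^ 2 ≤ 4 * Cr * ℓ ^ 2 / N := by
    refine div_le_div₀ (by positivity) (by nlinarith) hN0 (by nlinarith)
  have t4 : 8 / T ≤ 8 * ℓ ^ 2 / N := div_le_div₀ (by positivity) (by nlinarith) hN0 hTN
  have key : 2 * ((Ch * A + Cr + 2) * ℓ ^ 2 * (2 / N)) +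
      2 * (4 * ((Cr + 2) * ℓ ^ 2) / N + (4 * Cr * ℓ ^ 2 / N + 8 * ℓ ^ 2 / N)) =
      (4 * Ch * A + 20 * Cr + 40) * (ℓ ^ 2 / N) := by
    field_simp
    ring
  linarith

/-- **`∑_ρ m(ρ) g(ρ) = −2 ξ'/ξ(1)`** (`g(s) = 1/(s(s−1))`): the contour identity along the good
heights `T_N`, whose boundary integrals tend to `0` while the truncated sums tend to the
(absolutely convergent) sum. [cite: Edwards1974, §3.8 (4) and §7.6 (1)] -/
theorem hasSum_zeroOrder_mul_recipWeight :
    HasSum (fun ρ : RHWave0.riemannZetaNontrivialZeros ↦ (riemannZetaZeroOrder (ρ : ℂ) : ℂ) * recipWeight ρ)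
      (-2 * logDeriv riemannXi 1) := by
  have hsum := summable_norm_zeroOrder_mul_recipWeight.of_norm
  set S := ∑' ρ : RHWave0.riemannZetaNontrivialZeros, (riemannZetaZeroOrder (ρ : ℂ) : ℂ) * recipWeight ρ
    with hS
  suffices hS' : S = -2 * logDeriv riemannXi 1 by rw [← hS']; exact hsum.hasSum
  obtain ⟨Ch, hCh0, hCh⟩ := exists_norm_logDeriv_riemannXi_le
  obtain ⟨Cr, hCr0, hCr⟩ := exists_norm_logDeriv_riemannXi_le_of_re_ge
  obtain ⟨A, hA0, hA⟩ := exists_goodHeight_log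
  obtain ⟨δ, hδ, hδ2, hgap⟩ := exists_gap_im
  -- good heights `T N` with separations `η N` (junk below `N = 2`)
  have hgh : ∀ N : ℕ, ∃ T η : ℝ, 2 ≤ N → ((N : ℝ) ≤ T ∧ T ≤ N + 1 ∧ 0 < η ∧ η ≤ 1 / 2 ∧
      1 / η ≤ A * Real.log (N + 6) ∧ ∀ ρ ∈ RHWave0.riemannZetaNontrivialZeros, η ≤ |ρ.im - T|) := by
    intro N
    by_cases hN : 2 ≤ N
    · obtain ⟨T, h1, h2, η, h3, h4, h5, h6⟩ := hA N hN
      exact ⟨T, η, fun _ ↦ ⟨h1, h2, h3, h4, h5, h6⟩⟩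
    · exact ⟨0, 0, fun h ↦ absurd h hN⟩
  choose T η hTη using hgh
  -- the truncated sums along `T N` tend to `S`
  have hpart : Tendsto (fun N : ℕ ↦ ∑ ρ ∈ weilZeroFinset (T N),
      (riemannZetaZeroOrder (ρ : ℂ) : ℂ) * recipWeight ρ) atTop (𝓝 S) := by
    have h1 := hsum.hasSum.comp tendsto_weilZeroFinset
    have h2 : Tendsto T atTop atTop := by
      refine tendsto_atTop_mono' atTop ?_ tendsto_natCast_atTop_atTop
      filter_upwards [eventually_ge_atTop 2] with N hN using (hTη N hN).1
    exact h1.comp h2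
  -- the boundary integrals along `T N` tend to `0`
  have hbdry : Tendsto (fun N : ℕ ↦
      Literature.Analysis.Complex.rectBoundaryIntegral contourIntegrand (1 - T N) (T N) (-T N) (T N)) atTop (𝓝 0) := by
    refine squeeze_zero_norm' ?_
      (by simpa using (tendsto_log_sq_div.const_mul (4 * Ch * A + 20 * Cr + 40)))
    filter_upwards [eventually_ge_atTop 2] with N hN
    obtain ⟨h1, h2, h3, h4, h5, h6⟩ := hTη N hN
    have hN2 : (2 : ℝ) ≤ N := by exact_mod_cast hN
    exact (norm_rectBoundaryIntegral_le hCh hCr hCh0.le hCr0.le (by linarith) h3 (by linarith)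
      h6).trans (boundary_bound_le hCh0.le hCr0.le hA0.le hN h1 h2 h3 h5)
  -- the contour identity along the sequence
  have hid : ∀ᶠ N : ℕ in atTop,
      2 * π * I * ∑ ρ ∈ weilZeroFinset (T N), (riemannZetaZeroOrder (ρ : ℂ) : ℂ) * recipWeight ρ +
          4 * π * I * logDeriv riemannXi 1 =
        Literature.Analysis.Complex.rectBoundaryIntegral contourIntegrand (1 - T N) (T N) (-T N) (T N) := by
    filter_upwards [eventually_ge_atTop 2] with N hN
    obtain ⟨h1, h2, h3, h4, h5, h6⟩ := hTη N hN
    have hN2 : (2 : ℝ) ≤ N := by exact_mod_cast hN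
    refine (contour_identity hδ hδ2 hgap (by linarith) fun ρ hρ ↦ ⟨fun h ↦ ?_, fun h ↦ ?_⟩).symm
    · have := h6 ρ hρ
      rw [h, sub_self, abs_zero] at this
      linarith
    · have := h6 _ (ZetaZeros.riemannZetaNontrivialZeros.conj_mem hρ)
      rw [conj_im, h, neg_neg, sub_self, abs_zero] at this
      linarith
  have hlim2 : Tendsto (fun N : ℕ ↦
      2 * π * I * ∑ ρ ∈ weilZeroFinset (T N), (riemannZetaZeroOrder (ρ : ℂ) : ℂ) * recipWeight ρ +
        4 * π * I * logDeriv riemannXi 1) atTop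
      (𝓝 (2 * π * I * S + 4 * π * I * logDeriv riemannXi 1)) :=
    (hpart.const_mul _).add tendsto_const_nhds
  have heq : 2 * π * I * S + 4 * π * I * logDeriv riemannXi 1 = 0 :=
    tendsto_nhds_unique hlim2 (hbdry.congr' (hid.mono fun N h ↦ h.symm))
  have hπ : (2 * π * I : ℂ) ≠ 0 := by simp [Real.pi_ne_zero]
  have : 2 * π * I * S = 2 * π * I * (-2 * logDeriv riemannXi 1) := by linear_combination heq
  exact mul_left_cancel₀ hπ this

end ZetaZeroSum

/-! ## Main results -/

open ZetaZeroSum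

/-- **`ξ'/ξ(1) = β/2`** with `β = nicolasBeta = 2 + γ − log π − 2 log 2` (Edwards §3.8 (4):
`½γ + ½ log π + 1 − log 2π`). [cite: Edwards1974, §3.8 (4)] -/
theorem logDeriv_riemannXi_one : logDeriv riemannXi 1 = (nicolasBeta : ℂ) / 2 :=
  ZetaZeroSum.logDeriv_riemannXi_one

/-- **Absolute convergence of `∑_ρ m(ρ)/(ρ(1−ρ))`** over the non-trivial zeros of `ζ`
(unconditional). [cite: Nicolas2012, (1.3)] -/
theorem summable_norm_zeroOrder_div_mul_one_sub :
    Summable fun ρ : RHWave0.riemannZetaNontrivialZeros ↦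
      ‖(riemannZetaZeroOrder (ρ : ℂ) : ℂ) / ((ρ : ℂ) * (1 - ρ))‖ := by
  refine summable_norm_zeroOrder_mul_recipWeight.congr fun ρ ↦ ?_
  rw [recipWeight_eq_neg, mul_neg, norm_neg, mul_one_div]

/-- **Nicolas's `β` as the sum over the zeros** (Nicolas 2012, (1.3):
"`β = ∑_ρ 1/(ρ(1−ρ)) = 2 + γ − log π − 2 log 2 = 0.0461914179…`"): over the non-trivial zeros of
`ζ`, counted with multiplicity, `∑_ρ m(ρ)/(ρ(1−ρ)) = nicolasBeta`, the series converging
absolutely (`summable_norm_zeroOrder_div_mul_one_sub`). Unconditional. [cite: Nicolas2012, (1.3)] -/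
theorem hasSum_zeroOrder_div_mul_one_sub :
    HasSum (fun ρ : RHWave0.riemannZetaNontrivialZeros ↦
      (riemannZetaZeroOrder (ρ : ℂ) : ℂ) / ((ρ : ℂ) * (1 - ρ))) (nicolasBeta : ℂ) := by
  have h := hasSum_zeroOrder_mul_recipWeight.neg
  have hv : -(-2 * logDeriv riemannXi 1) = (nicolasBeta : ℂ) := by
    rw [ZetaZeroSum.logDeriv_riemannXi_one]; ring
  rw [hv] at h
  refine h.congr_fun fun ρ ↦ ?_
  rw [recipWeight_eq_neg]
  ring

/-- `∑' ρ, m(ρ)/(ρ(1−ρ)) = β`. [cite: Nicolas2012, (1.3)] -/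
theorem tsum_zeroOrder_div_mul_one_sub_eq_nicolasBeta :
    ∑' ρ : RHWave0.riemannZetaNontrivialZeros, (riemannZetaZeroOrder (ρ : ℂ) : ℂ) / ((ρ : ℂ) * (1 - ρ)) =
      nicolasBeta :=
  hasSum_zeroOrder_div_mul_one_sub.tsum_eq

/-- `0.045 < β` (`γ > 0.5772`, `log π < 1.1459`, `log 2 < 0.693148`). [folklore] -/
theorem nicolasBeta_gt : (0.045 : ℝ) < nicolasBeta := by
  unfold nicolasBeta
  have := Literature.Analysis.SpecialFunctions.Real.eulerMascheroniConstant_gt_d8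
  have := log_pi_lt
  have := Real.log_two_lt_d9
  linarith

/-- `β < 0.0474` (`γ < 0.5773`, `log π > 1.1436`, `log 2 > 0.693147`). [folklore] -/
theorem nicolasBeta_lt' : nicolasBeta < 0.0474 := by
  unfold nicolasBeta
  have := Literature.Analysis.SpecialFunctions.Real.eulerMascheroniConstant_lt_d8
  have := log_pi_gt
  have := Real.log_two_gt_d9
  linarith

/-! ### Under the Riemann hypothesis -/

/-- Under RH, `1 − ρ = ρ̄` at a non-trivial zero, so `ρ(1−ρ) = |ρ|²`. [cite: Nicolas2012, §1 ("Under RH, 1 − ρ = ρ̄")] -/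
theorem mul_one_sub_eq_norm_sq_of_RH (hRH : RiemannHypothesis) {ρ : ℂ}
    (hρ : ρ ∈ RHWave0.riemannZetaNontrivialZeros) : ρ * (1 - ρ) = ((‖ρ‖ ^ 2 : ℝ) : ℂ) := by
  have hre : ρ.re = 1 / 2 := by
    refine hRH ρ (ZetaZeros.riemannZetaNontrivialZeros.zeta_eq_zero hρ) ?_ (ZetaZeros.riemannZetaNontrivialZeros.ne_one hρ)
    rintro ⟨n, hn⟩
    have := ZetaZeros.riemannZetaNontrivialZeros.re_pos hρ
    rw [hn] at this
    simp at this
    linarith [(n.cast_nonneg : (0 : ℝ) ≤ n)]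
  have h1 : 1 - ρ = conj ρ := by
    apply Complex.ext
    · simp [hre]; norm_num
    · simp
  rw [h1, Complex.mul_conj, Complex.normSq_eq_norm_sq]

/-- **Under RH, `∑_ρ m(ρ)/|ρ|² = β`.** [cite: Nicolas2012, (1.3) and (1.19)] -/
theorem hasSum_zeroOrder_div_norm_sq_of_RH (hRH : RiemannHypothesis) :
    HasSum (fun ρ : RHWave0.riemannZetaNontrivialZeros ↦ (riemannZetaZeroOrder (ρ : ℂ) : ℝ) / ‖(ρ : ℂ)‖ ^ 2)
      nicolasBeta := by
  have h := (hasSum_zeroOrder_div_mul_one_sub).mapL Complex.reCLM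
  simp only [Complex.reCLM_apply, Complex.ofReal_re] at h
  refine h.congr_fun fun ρ ↦ ?_
  rw [mul_one_sub_eq_norm_sq_of_RH hRH ρ.2]
  norm_cast

/-- Under RH every finite partial sum of `m(ρ)/|ρ|²` is at most `β`. [cite: Nicolas2012, (1.19)] -/
theorem sum_zeroOrder_div_norm_sq_le_nicolasBeta (hRH : RiemannHypothesis)
    (F : Finset RHWave0.riemannZetaNontrivialZeros) :
    ∑ ρ ∈ F, (riemannZetaZeroOrder (ρ : ℂ) : ℝ) / ‖(ρ : ℂ)‖ ^ 2 ≤ nicolasBeta :=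
  sum_le_hasSum F (fun ρ _ ↦ div_nonneg (zeroOrder_nonneg ρ) (sq_nonneg _))
    (hasSum_zeroOrder_div_norm_sq_of_RH hRH)

/-- **Nicolas 2012, (1.19): `|W(x)| ≤ β` under RH**, in the general form: for any coefficients
`c(ρ)` with `|c(ρ)| ≤ 1` (for `W(x) = ∑_ρ x^{i Im ρ}/(ρ(1−ρ))` take `c(ρ) = x^{i Im ρ}`), the series
`∑_ρ m(ρ) c(ρ)/(ρ(1−ρ))` converges absolutely and has modulus `≤ β`.
[cite: Nicolas2012, (1.18)–(1.19)] -/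
theorem norm_tsum_zeroOrder_mul_div_le_nicolasBeta (hRH : RiemannHypothesis) {c : ℂ → ℂ}
    (hc : ∀ ρ ∈ RHWave0.riemannZetaNontrivialZeros, ‖c ρ‖ ≤ 1) :
    Summable (fun ρ : RHWave0.riemannZetaNontrivialZeros ↦
        ‖(riemannZetaZeroOrder (ρ : ℂ) : ℂ) * c ρ / ((ρ : ℂ) * (1 - ρ))‖) ∧
      ‖∑' ρ : RHWave0.riemannZetaNontrivialZeros,
          (riemannZetaZeroOrder (ρ : ℂ) : ℂ) * c ρ / ((ρ : ℂ) * (1 - ρ))‖ ≤ nicolasBeta := by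
  have hle : ∀ ρ : RHWave0.riemannZetaNontrivialZeros,
      ‖(riemannZetaZeroOrder (ρ : ℂ) : ℂ) * c ρ / ((ρ : ℂ) * (1 - ρ))‖ ≤
        (riemannZetaZeroOrder (ρ : ℂ) : ℝ) / ‖(ρ : ℂ)‖ ^ 2 := by
    intro ρ
    have hm : (0 : ℝ) ≤ riemannZetaZeroOrder (ρ : ℂ) := by
      exact_mod_cast riemannZetaZeroOrder_nonneg (ZetaZeros.riemannZetaNontrivialZeros.ne_one ρ.2)
    rw [mul_one_sub_eq_norm_sq_of_RH hRH ρ.2, norm_div, norm_mul, Complex.norm_intCast,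
      abs_of_nonneg hm, Complex.norm_real, Real.norm_eq_abs, abs_of_nonneg (sq_nonneg _)]
    refine div_le_div_of_nonneg_right ?_ (sq_nonneg _)
    calc (riemannZetaZeroOrder (ρ : ℂ) : ℝ) * ‖c ρ‖ ≤ (riemannZetaZeroOrder (ρ : ℂ) : ℝ) * 1 :=
          mul_le_mul_of_nonneg_left (hc _ ρ.2) hm
      _ = _ := mul_one _
  have hS := hasSum_zeroOrder_div_norm_sq_of_RH hRH
  have hsum : Summable fun ρ : RHWave0.riemannZetaNontrivialZeros ↦
      ‖(riemannZetaZeroOrder (ρ : ℂ) : ℂ) * c ρ / ((ρ : ℂ) * (1 - ρ))‖ :=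
    Summable.of_nonneg_of_le (fun _ ↦ norm_nonneg _) hle hS.summable
  refine ⟨hsum, ?_⟩
  calc _ ≤ ∑' ρ : RHWave0.riemannZetaNontrivialZeros,
        ‖(riemannZetaZeroOrder (ρ : ℂ) : ℂ) * c ρ / ((ρ : ℂ) * (1 - ρ))‖ := norm_tsum_le_tsum_norm hsum
    _ ≤ ∑' ρ : RHWave0.riemannZetaNontrivialZeros, (riemannZetaZeroOrder (ρ : ℂ) : ℝ) / ‖(ρ : ℂ)‖ ^ 2 :=
        hsum.tsum_le_tsum hle hS.summable
    _ = nicolasBeta := hS.tsum_eq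

end Literature.NumberTheory.LFunctions

end
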